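import Literature.NumberTheory.Sieve.HeathBrownCubicUpperBoundTools
import Literature.NumberTheory.Sieve.SieveFrameworkUpperBound
import Literature.NumberTheory.Sieve.SieveFrameworkProofs
import Literature.NumberTheory.Sieve.PolynomialValuesSieveBounds
import Literature.NumberTheory.LFunctions.DegreeOnePrimesPNT
import Mathlib.Analysis.MeanInequalitiesPow
import HarnessLib

/-!
# Heath-Brown's Lemma 7.1 for `ℬ^(K)`: an upper-bound sieve on the norms of the ideals of `ℚ(2^{1/3})`

Pure-proof companion of `HeathBrownCubicUpperBound` (the named fact
`HeathBrown2001_lemma_7_1_normWeighted`, Heath-Brown's upper-bound sieve Lemma 7.1, *Primes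
represented by `x³ + 2y³`*, Acta Math. 186 (2001), p. 39) in the decomposition of **parity.S18**.
Lemma 7.1 has an `𝒜^(K)`-half and a `ℬ^(K)`-half; this file PROVES the `ℬ^(K)`-half,

* `HeathBrown2001_lemma_7_1_B` — for `0 < ϖ ≤ 1` there are `C, X₀` with
  `∑_{N(Q)∈𝒬} S_K(ℬ^(K)_Q, z) ≤ C (ηX³/log min(z, X^{2−τ}/N) · ∑_{N(Q)∈𝒬} N(Q)^{-1} + X^{3−τ/5})`
  for all `X ≥ X₀`, `exp(−(log X)^{1/3}) ≤ η ≤ 1`, `τ = (log log X)^{−ϖ}`, `z ≥ X^τ`,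
  `0 < N ≤ X^{2−2τ}` and finite sets `𝒬` of square-free integers in `(N, 2N]` — verbatim the second
  conjunct of `HeathBrown2001_lemma_7_1_normWeighted ϖ` (there `ϖ < 1/5`),

unconditionally, from results proved in the tree: the beta-sieve upper bound for a sifted sequence
of finite dimension (`SieveSequence.sifted_le_of_dvd_primesProdBelow`, Greaves Thm 3.3.1 /
Friedlander–Iwaniec Thm 6.9), the Weber–Landau ideal count `I_K(x) = γ₀x + O(x^{2/3})`
(`idealCount_sub_residue_mul_le_holds`, Heath-Brown's Lemma 4.1) and Mertens' theorem for the
degree-one primes of `K` (`sum_primesLE_idealNormCount_div_eq`, from the prime ideal theorem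
`primeIdealTheorem_holds`). The `𝒜^(K)`-half needs in addition the Type I bound Lemma 3.2
(`HeathBrown2001_typeI_A`, level of distribution `X^{2−ε}` for the binary form) and is not treated
here.

## The argument (Heath-Brown pp. 40–41, with the beta-sieve for Selberg's sieve and Lemma 4.1 for Lemma 3.3)

Fix `Q` with `N(Q) = q ∈ 𝒬` and put `Y = 3X³/q`, `z₁ = min(z, X^{2−τ}/N) ≥ X^τ`, `D = z₁`,
`z₂ = z₁^{1/28}`.
1. (`siftedB_le_windowSeq_sifted`, the inequality half of (6.4), p. 35.) A member `J = Q·J'` of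
   `ℬ^(K)_Q` whose prime factors all have norm `≥ z` has `Y < N(J') ≤ Y(1+η)` and `N(J')` free of
   rational primes `p < z₂` (a prime of `𝓞_K` above `p` has norm `≤ p³ < z₂³ ≤ z`). So
   `S_K(ℬ^(K)_Q, z) ≤ S(𝒜_Y, P(z₂))`, the sifted sum of the *window sequence*
   `a_n = #{J' : N(J') = n ∈ (Y, Y(1+η)]}` (`windowSeq`).
2. (`exists_windowDvdCount_sub_le`, the Type I input, cf. Lemma 2.2 and (5.7), p. 32.)
   `#{J' : Y < N(J') ≤ Y(1+η), d ∣ N(J')} = γ₀ηY g(d) + O(8^{ω(d)} (2Y/d + 1)^{2/3})` uniformly, for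
   square-free `d`, with the multiplicative density `g(p) = 1 − ∏_{P ∣ p}(1 − N(P)^{-1})`
   (`normDensity`; Heath-Brown's `ρ₁(p)/p`): by induction on `ω(d)`, splitting off `p = minFac d`
   with the inclusion–exclusion `#{p ∤ N(J)} = ∑_{S ⊆ 𝔓_p} (−1)^{|S|} #{∏_S P ∣ J}` over the `≤ 3`
   primes `𝔓_p` above `p` (`card_filter_not_dvd_absNorm_eq_sum`), the scaling `J = (∏_S P)·J''`
   (`card_filter_dvd_and_dvd_eq`) and the Weber–Landau count at the base (`windowDvdCount_one`,
   `exists_idealCount_sub_le`).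
3. (`hasSieveDimension_normDensity`, `exists_prod_one_sub_normDensityAt_le`.) `0 ≤ g(p) < 1`,
   `(1 − g(p))^{-1} ≤ (1 − 1/p)^{-3}`, so `g` has sieve dimension `≤ 3` with an absolute constant
   (crude, but only constants depend on it), and `V(z) = ∏_{p<z}(1 − g(p)) ≤ K_V/log z` since
   `g(p) ≥ c_K(p)/p − 3/p²` and `∑_{p ≤ x} c_K(p)/p = log log x + c + O(1/log x)`.
4. (`siftedB_le_main_add_err`.) The beta-sieve bound at level `D = z₁ = z₂^{28}`:
   `S(𝒜_Y, P(z₂)) ≤ (1 + 2K₃^{10}) γ₀ηY V(z₂) + ∑_{d ∣ P(z₂), d ≤ D} |R_d|`, the main term being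
   `≤ 84(1+2K₃^{10})γ₀K_V · ηX³/(q log z₁)` and (`sum_abs_remainder_windowSeq_le`) the remainder
   `≤ C_W ((2Y)^{2/3}D^{1/3} + D) e^{32}(log z₂)^8`.
5. (`total_err_le`, `card_normIn_le_of`, `HeathBrown2001_lemma_7_1_B`.) Summing over the
   `≤ I_K(2N) + 1 ≪ N` ideals `Q` with `N(Q) ∈ 𝒬` gives the main term of the lemma and a total
   remainder `≪ X^{8/3}(log X)^8 ≤ X^{3−τ/5}` once `X` is large (`eventually_params_B`: `X ≥ 16`,
   `τ ≤ 1/8`, `τ log X ≥ 20`, `C(log X)^8 ≤ X^{1/4}`).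

## References

* D. R. Heath-Brown, *Primes represented by `x³ + 2y³`*, Acta Math. 186 (2001), 1–84: Lemma 7.1
  (p. 39) and its proof (pp. 40–41); (6.4) (p. 35); Lemma 2.2, Lemma 4.1, (5.7) (pp. 6, 22, 32).
  [cite: HeathBrownActa2001, Lemma 7.1]
* G. Greaves, *Sieves in Number Theory*, Springer (2001), Thm 3.3.1 (the upper-bound sieve used,
  through `SieveFrameworkUpperBound`). [cite: Greaves2001, §3.3.4 Thm 1]

## Mathlib / tree search

Mathlib: no sieve over number fields; used `Ideal.finite_setOf_absNorm_le` (via `idealsLE`),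
`Ideal.prod_normalizedFactors_eq_self`, `Prime.exists_mem_multiset_map_dvd`,
`Finset.prod_dvd_of_coprime`, `Ideal.IsMaximal.coprime_of_ne`, `Finset.prod_one_add`,
`Finset.card_bij`, `ArithmeticFunction.prodPrimeFactors`,
`IsMultiplicative.prodPrimeFactors_one_add_of_squarefree`, `Real.rpow_add_le_add_rpow`,
`isLittleO_log_rpow_rpow_atTop`, `Real.isLittleO_log_id_atTop`. Tree: `SieveFramework`
(`SieveSequence`, `HasSieveDimension`, `primesProdBelow`), `SieveFrameworkUpperBound`
(`sifted_le_of_dvd_primesProdBelow`), `SieveFrameworkProofs` (`sum_primesWindow_one_div_le`), `PolynomialValuesSieveBounds`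
(`sum_primesBelow_one_div_le`),
`DegreeOnePrimesPNT` (`sum_primesLE_idealNormCount_div_eq`), `IdealCountProofs`
(`idealCount_sub_residue_mul_le_holds`), `MertensElementary` (`MertensBound.sum_inv_prime_le`,
`sum_inv_prime_mul_pred_le_one`), `HeathBrownCubicUpperBoundTools` (`card_idealsLE_eq`,
`exists_absNorm_eq_prime_pow_le_three`, `eventually_upperBound_params`),
`HeathBrownCubicUpperBound` (`normIn`), `HeathBrownCubicSieveSetup` (`siftedB`, `BIdeals`,
`normWindow`, `gamma₀`), `HeathBrownCubicSieveDecomposition` (`hbTau`), `CubeRootTwoField`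
(`finrank_K`), `IdealNormCount` (`card_primesOver_le`).
-/

noncomputable section

open NumberField Finset Filter Topology
open scoped nonZeroDivisors

namespace Literature.NumberTheory.Sieve.CubicSieve

open LFunctions.CubeRootTwoField
open Literature.NumberTheory.LFunctions (idealNormCount)
open Literature.NumberTheory.LFunctions.NumberField (idealCount)

/-! ### Primes of `𝓞_K` above a rational prime -/

/-- The (nonzero) prime ideals of `𝓞_K` above the rational prime `p`, as a finite set: the primes
`P` with `p ∣ N(P)` (equivalently `N(P) = p^f`, `1 ≤ f ≤ 3`). [folklore] -/
def primesAbove (p : ℕ) : Finset (Ideal (𝓞 K)) :=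
  open scoped Classical in
  {P ∈ idealsLE (p ^ 3) | P.IsPrime ∧ P ≠ ⊥ ∧ p ∣ Ideal.absNorm P}

/-- Membership in `primesAbove p`: the bounding norm is redundant. [folklore] -/
theorem mem_primesAbove_iff {p : ℕ} (hp : p.Prime) {P : Ideal (𝓞 K)} :
    P ∈ primesAbove p ↔ P.IsPrime ∧ P ≠ ⊥ ∧ p ∣ Ideal.absNorm P := by
  classical
  simp only [primesAbove, mem_filter, mem_idealsLE, and_iff_right_iff_imp]
  rintro ⟨hP, hP0, hpN⟩
  obtain ⟨q, f, hq, hf, hf3, hN, -⟩ := exists_absNorm_eq_prime_pow_le_three hP hP0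
  have hpq : p = q := (Nat.prime_dvd_prime_iff_eq hp hq).mp (hp.dvd_of_dvd_pow (hN ▸ hpN))
  subst hpq
  rw [hN]
  exact Nat.pow_le_pow_right hp.pos hf3

/-- A prime above `p` has norm `p^f` with `1 ≤ f ≤ 3`. [folklore] -/
theorem exists_absNorm_eq_pow_of_mem_primesAbove {p : ℕ} (hp : p.Prime) {P : Ideal (𝓞 K)}
    (hP : P ∈ primesAbove p) : ∃ f : ℕ, 0 < f ∧ f ≤ 3 ∧ Ideal.absNorm P = p ^ f := by
  obtain ⟨hPp, hP0, hpN⟩ := (mem_primesAbove_iff hp).mp hP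
  obtain ⟨q, f, hq, hf, hf3, hN, -⟩ := exists_absNorm_eq_prime_pow_le_three hPp hP0
  have hpq : p = q := (Nat.prime_dvd_prime_iff_eq hp hq).mp (hp.dvd_of_dvd_pow (hN ▸ hpN))
  subst hpq
  exact ⟨f, hf, hf3, hN⟩

/-- A prime above `p` has norm at least `p`. [folklore] -/
theorem le_absNorm_of_mem_primesAbove {p : ℕ} (hp : p.Prime) {P : Ideal (𝓞 K)}
    (hP : P ∈ primesAbove p) : p ≤ Ideal.absNorm P := by
  obtain ⟨f, hf, -, hN⟩ := exists_absNorm_eq_pow_of_mem_primesAbove hp hP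
  rw [hN]
  exact Nat.le_self_pow hf.ne' p

/-- Members of `primesAbove p` are nonzero primes. [folklore] -/
theorem isPrime_of_mem_primesAbove {p : ℕ} {P : Ideal (𝓞 K)} (hP : P ∈ primesAbove p) :
    P.IsPrime ∧ P ≠ ⊥ := by
  classical
  simp only [primesAbove, mem_filter] at hP
  exact ⟨hP.2.1, hP.2.2.1⟩

/-- At most `3 = [K:ℚ]` primes lie above `p`. [folklore] -/
theorem card_primesAbove_le {p : ℕ} (hp : p.Prime) : #(primesAbove p) ≤ 3 := by
  classical
  have hsub : ((primesAbove p : Finset (Ideal (𝓞 K))) : Set (Ideal (𝓞 K))) ⊆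
      (Ideal.span {(p : ℤ)}).primesOver (𝓞 K) := by
    intro P hP
    rw [Finset.mem_coe] at hP
    obtain ⟨hPp, hP0, hpN⟩ := (mem_primesAbove_iff hp).mp hP
    obtain ⟨q, f, hq, hf, -, hN, hover⟩ := exists_absNorm_eq_prime_pow_le_three hPp hP0
    have hpq : p = q := (Nat.prime_dvd_prime_iff_eq hp hq).mp (hp.dvd_of_dvd_pow (hN ▸ hpN))
    subst hpq
    exact hover
  haveI := Fact.mk hp
  have hfin : ((Ideal.span {(p : ℤ)}).primesOver (𝓞 K)).Finite :=
    IsDedekindDomain.primesOver_finite _ _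
  calc #(primesAbove p)
      = (((primesAbove p : Finset (Ideal (𝓞 K))) : Set (Ideal (𝓞 K)))).ncard := by
        rw [Set.ncard_coe_finset]
    _ ≤ ((Ideal.span {(p : ℤ)}).primesOver (𝓞 K)).ncard := Set.ncard_le_ncard hsub hfin
    _ = Nat.card ((Ideal.span {(p : ℤ)}).primesOver (𝓞 K)) := (Nat.card_coe_set_eq _).symm
    _ ≤ Module.finrank ℚ K :=
        Literature.NumberTheory.LFunctions.IdealNormCount.card_primesOver_le K hp
    _ = 3 := finrank_K

/-- **`p ∣ N(J)` iff some prime above `p` divides `J`** (`J ≠ 0`): the norm is multiplicative over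
the prime factorisation of `J`. [folklore] -/
theorem dvd_absNorm_iff_exists_mem_primesAbove {p : ℕ} (hp : p.Prime) {J : Ideal (𝓞 K)}
    (hJ : J ≠ ⊥) : p ∣ Ideal.absNorm J ↔ ∃ P ∈ primesAbove p, P ∣ J := by
  classical
  constructor
  · intro h
    have hprod : Ideal.absNorm J =
        ((UniqueFactorizationMonoid.normalizedFactors J).map Ideal.absNorm).prod := by
      rw [← map_multiset_prod, Ideal.prod_normalizedFactors_eq_self hJ]
    rw [hprod] at h
    obtain ⟨P, hPmem, hpP⟩ := Prime.exists_mem_multiset_map_dvd (Nat.prime_iff.mp hp)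
      (s := UniqueFactorizationMonoid.normalizedFactors J) (f := fun P => Ideal.absNorm P) h
    have hPprime : Prime P := UniqueFactorizationMonoid.prime_of_normalized_factor P hPmem
    refine ⟨P, (mem_primesAbove_iff hp).mpr ⟨Ideal.isPrime_of_prime hPprime, hPprime.ne_zero, hpP⟩,
      UniqueFactorizationMonoid.dvd_of_mem_normalizedFactors hPmem⟩
  · rintro ⟨P, hP, hPJ⟩
    exact (((mem_primesAbove_iff hp).mp hP).2.2).trans
      (Ideal.absNorm_dvd_absNorm_of_le (Ideal.le_of_dvd hPJ))

/-- A product of distinct nonzero primes divides `J` iff each of them does (distinct maximal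
ideals are pairwise coprime). [folklore] -/
theorem ideal_prod_dvd_iff_forall_dvd {S : Finset (Ideal (𝓞 K))} (hS : ∀ P ∈ S, P.IsPrime ∧ P ≠ ⊥)
    {J : Ideal (𝓞 K)} : (∏ P ∈ S, P) ∣ J ↔ ∀ P ∈ S, P ∣ J := by
  constructor
  · intro h P hP
    exact dvd_trans (Finset.dvd_prod_of_mem (fun Q : Ideal (𝓞 K) => Q) hP) h
  · intro h
    have hcop : ((S : Set (Ideal (𝓞 K)))).Pairwise
        (Function.onFun IsCoprime fun Q : Ideal (𝓞 K) => Q) := by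
      intro P hP P' hP' hne
      exact Ideal.isCoprime_iff_sup_eq.mpr
        (((hS P hP).1.isMaximal (hS P hP).2).coprime_of_ne
          ((hS P' hP').1.isMaximal (hS P' hP').2) hne)
    exact Finset.prod_dvd_of_coprime (s := fun Q : Ideal (𝓞 K) => Q) hcop h

/-- The norm of a product of primes above `p` is at least `p` as soon as the product is
non-empty, and is a power of `p`. [folklore] -/
theorem absNorm_prod_primesAbove {p : ℕ} (hp : p.Prime) {S : Finset (Ideal (𝓞 K))}
    (hS : S ⊆ primesAbove p) :
    ∃ m : ℕ, Ideal.absNorm (∏ P ∈ S, P) = p ^ m ∧ (S.Nonempty → 0 < m) := by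
  classical
  induction S using Finset.induction_on with
  | empty => exact ⟨0, by simp, fun h => absurd h Finset.not_nonempty_empty⟩
  | insert P S hPS ih =>
    obtain ⟨m, hm, -⟩ := ih ((Finset.subset_insert _ _).trans hS)
    obtain ⟨f, hf, -, hN⟩ :=
      exists_absNorm_eq_pow_of_mem_primesAbove hp (hS (Finset.mem_insert_self _ _))
    refine ⟨f + m, ?_, fun _ => by omega⟩
    rw [Finset.prod_insert hPS, map_mul, hm, hN, pow_add]

/-- A product of primes above `p` is a nonzero ideal. [folklore] -/
theorem prod_primesAbove_ne_bot {p : ℕ} {S : Finset (Ideal (𝓞 K))} (hS : S ⊆ primesAbove p) :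
    (∏ P ∈ S, P) ≠ ⊥ := by
  rw [Ne, ← Ideal.zero_eq_bot, Finset.prod_eq_zero_iff]
  rintro ⟨P, hP, hP0⟩
  rw [Ideal.zero_eq_bot] at hP0
  exact (isPrime_of_mem_primesAbove (hS hP)).2 hP0

/-! ### Ideals with norm in a window `(Y, Y(1+η)]`, and those with `d ∣ N(J)` -/

/-- The ideals `J` of `𝓞_K` with `Y < N(J) ≤ Y(1+η)` (so `ℬ^(K) = idealWindow (3X³) η`,
`normWindow_eq_idealWindow`). [cite: HeathBrownActa2001, §3 p. 10] -/
def idealWindow (Y η : ℝ) : Finset (Ideal (𝓞 K)) :=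
  {J ∈ idealsLE ⌊Y * (1 + η)⌋₊ | Y < (Ideal.absNorm J : ℝ) ∧ (Ideal.absNorm J : ℝ) ≤ Y * (1 + η)}

/-- Membership in `idealWindow`: the bounding norm is redundant. [folklore] -/
theorem mem_idealWindow_iff {Y η : ℝ} {J : Ideal (𝓞 K)} :
    J ∈ idealWindow Y η ↔ Y < (Ideal.absNorm J : ℝ) ∧ (Ideal.absNorm J : ℝ) ≤ Y * (1 + η) := by
  simp only [idealWindow, mem_filter, mem_idealsLE, and_iff_right_iff_imp]
  rintro ⟨-, h⟩
  exact Nat.le_floor h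

/-- `ℬ^(K)` is the window at `Y = 3X³`. [folklore] -/
theorem normWindow_eq_idealWindow (X η : ℝ) : normWindow X η = idealWindow (3 * X ^ 3) η := rfl

/-- Members of a window with `Y ≥ 0` are nonzero ideals. [folklore] -/
theorem ne_bot_of_mem_idealWindow {Y η : ℝ} (hY : 0 ≤ Y) {J : Ideal (𝓞 K)}
    (hJ : J ∈ idealWindow Y η) : J ≠ ⊥ := by
  rintro rfl
  rw [mem_idealWindow_iff, Ideal.absNorm_bot, Nat.cast_zero] at hJ
  linarith [hJ.1]

/-- Members of a window with `Y ≥ 0` have positive norm. [folklore] -/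
theorem absNorm_pos_of_mem_idealWindow {Y η : ℝ} (hY : 0 ≤ Y) {J : Ideal (𝓞 K)}
    (hJ : J ∈ idealWindow Y η) : 0 < Ideal.absNorm J := by
  have h := (mem_idealWindow_iff.mp hJ).1
  exact_mod_cast hY.trans_lt h

/-- `W(Y, η, d) = #{J : Y < N(J) ≤ Y(1+η), d ∣ N(J)}`: the congruence sums of the multiset of norms
of the ideals in a window (for `Y = 3X³/q` these are the quantities behind `#ℬ_{qd}` of Lemma 2.2).
[cite: HeathBrownActa2001, Lemma 2.2] -/
def windowDvdCount (Y η : ℝ) (d : ℕ) : ℕ := #{J ∈ idealWindow Y η | d ∣ Ideal.absNorm J}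

/-- The ideals of norm `≤ t` (`0 ≤ t`, `⌊t⌋ ≤ M`) inside `idealsLE M` number `I_K(t) + 1` (the zero
ideal included). [folklore] -/
theorem card_filter_absNorm_le {M : ℕ} {t : ℝ} (ht : 0 ≤ t) (htM : ⌊t⌋₊ ≤ M) :
    (#{J ∈ idealsLE M | (Ideal.absNorm J : ℝ) ≤ t} : ℝ) = idealCount K t + 1 := by
  have hset : {J ∈ idealsLE M | (Ideal.absNorm J : ℝ) ≤ t} = idealsLE ⌊t⌋₊ := by
    ext J
    simp only [mem_filter, mem_idealsLE]
    rw [← Nat.le_floor_iff ht]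
    exact ⟨fun h => h.2, fun h => ⟨h.trans htM, h⟩⟩
  rw [hset, card_idealsLE_eq,
    Literature.NumberTheory.LFunctions.NumberField.idealCount_eq_idealCount_floor (K := K) ht]

/-- `W(Y, η, 1) = I_K(Y(1+η)) − I_K(Y)` for `Y, η ≥ 0`. [folklore] -/
theorem windowDvdCount_one {Y η : ℝ} (hY : 0 ≤ Y) (hη : 0 ≤ η) :
    (windowDvdCount Y η 1 : ℝ) = idealCount K (Y * (1 + η)) - idealCount K Y := by
  have hY' : Y ≤ Y * (1 + η) := by nlinarith
  have hY0' : 0 ≤ Y * (1 + η) := hY.trans hY'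
  set M : ℕ := ⌊Y * (1 + η)⌋₊ with hM
  set A : Finset (Ideal (𝓞 K)) := {J ∈ idealsLE M | (Ideal.absNorm J : ℝ) ≤ Y * (1 + η)} with hA
  set B : Finset (Ideal (𝓞 K)) := {J ∈ idealsLE M | (Ideal.absNorm J : ℝ) ≤ Y} with hB
  have hcardA : (#A : ℝ) = idealCount K (Y * (1 + η)) + 1 := card_filter_absNorm_le hY0' le_rfl
  have hcardB : (#B : ℝ) = idealCount K Y + 1 :=
    card_filter_absNorm_le hY (Nat.floor_le_floor hY')
  have hsplit := Finset.card_filter_add_card_filter_not (s := A) (fun J => (Ideal.absNorm J : ℝ) ≤ Y)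
  have hB' : {J ∈ A | (Ideal.absNorm J : ℝ) ≤ Y} = B := by
    rw [hA, hB, filter_filter]
    exact filter_congr fun J _ => ⟨fun h => h.2, fun h => ⟨h.trans hY', h⟩⟩
  have hW' : {J ∈ A | ¬ (Ideal.absNorm J : ℝ) ≤ Y} =
      {J ∈ idealWindow Y η | 1 ∣ Ideal.absNorm J} := by
    rw [hA, filter_filter, idealWindow, filter_filter]
    exact filter_congr fun J _ =>
      ⟨fun h => ⟨⟨not_le.mp h.2, h.1⟩, one_dvd _⟩, fun h => ⟨h.1.2, not_le.mpr h.1.1⟩⟩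
  rw [windowDvdCount, ← hW']
  have hdiff : (#{J ∈ A | ¬ (Ideal.absNorm J : ℝ) ≤ Y} : ℝ) = #A - #B := by
    rw [← hB']
    have h := congrArg (Nat.cast (R := ℝ)) hsplit
    push_cast at h
    linarith
  rw [hdiff, hcardA, hcardB]
  ring

/-- **The Weber–Landau ideal count, uniform form**: `|I_K(t) − γ₀ t| ≤ C (t + 1)^{2/3}` for all
`t ≥ 0` (for `t ≥ 1` this is `idealCount_sub_residue_mul_le_holds` with `d = 3`; for `t < 1`,
`I_K(t) = 0`). [cite: HeathBrownActa2001, Lemma 4.1] -/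
theorem exists_idealCount_sub_le :
    ∃ C : ℝ, 0 ≤ C ∧ ∀ t : ℝ, 0 ≤ t →
      |(idealCount K t : ℝ) - gamma₀ * t| ≤ C * (t + 1) ^ (2 / 3 : ℝ) := by
  obtain ⟨C₀, hC₀⟩ :=
    Literature.NumberTheory.LFunctions.NumberField.idealCount_sub_residue_mul_le_holds K
  have hρ0 : 0 < gamma₀ := gamma₀_pos
  have hC₀0 : 0 ≤ C₀ := by
    have h := hC₀ 1 le_rfl
    simp only [Real.one_rpow, mul_one] at h
    exact (abs_nonneg _).trans h
  refine ⟨C₀ + gamma₀, by positivity, fun t ht => ?_⟩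
  have h1 : (1 : ℝ) ≤ (t + 1) ^ (2 / 3 : ℝ) := Real.one_le_rpow (by linarith) (by norm_num)
  rcases lt_or_ge t 1 with ht1 | ht1
  · have h0 : idealCount K t = 0 := by
      rw [Literature.NumberTheory.LFunctions.NumberField.idealCount_eq_idealCount_floor (K := K) ht,
        Nat.floor_eq_zero.mpr ht1,
        Literature.NumberTheory.LFunctions.NumberField.idealCount_natCast_eq_sum]
      simp
    rw [h0, Nat.cast_zero, zero_sub, abs_neg, abs_of_nonneg (by positivity)]
    calc gamma₀ * t ≤ gamma₀ * 1 := by gcongr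
      _ ≤ (C₀ + gamma₀) * 1 := by nlinarith
      _ ≤ (C₀ + gamma₀) * (t + 1) ^ (2 / 3 : ℝ) := by gcongr
  · have h := hC₀ t ht1
    rw [finrank_K] at h
    have hexp : t ^ (1 - 1 / ((3 : ℕ) : ℝ)) = t ^ (2 / 3 : ℝ) := by norm_num
    rw [hexp] at h
    change |(idealCount K t : ℝ) - NumberField.dedekindZeta_residue K * t| ≤ _
    calc |(idealCount K t : ℝ) - NumberField.dedekindZeta_residue K * t|
        ≤ C₀ * t ^ (2 / 3 : ℝ) := h
      _ ≤ C₀ * (t + 1) ^ (2 / 3 : ℝ) := by gcongr; linarith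
      _ ≤ (C₀ + gamma₀) * (t + 1) ^ (2 / 3 : ℝ) := by gcongr; linarith

/-! ### Inclusion–exclusion over the primes above one rational prime -/

open scoped Classical in
/-- **`#{J ∈ V : p ∤ N(J)} = ∑_{S ⊆ 𝔓_p} (−1)^{|S|} #{J ∈ V : ∏_{P∈S} P ∣ J}`** for a finite set `V` of
nonzero ideals: inclusion–exclusion over the primes `𝔓_p` above `p`, since `p ∤ N(J)` iff no prime
above `p` divides `J`. [folklore] -/
theorem card_filter_not_dvd_absNorm_eq_sum {p : ℕ} (hp : p.Prime) (V : Finset (Ideal (𝓞 K)))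
    (hV : ∀ J ∈ V, J ≠ ⊥) :
    (#{J ∈ V | ¬ p ∣ Ideal.absNorm J} : ℝ) =
      ∑ S ∈ (primesAbove p).powerset, (-1 : ℝ) ^ #S * #{J ∈ V | (∏ P ∈ S, P) ∣ J} := by
  classical
  have key : ∀ J ∈ V, (if ¬ p ∣ Ideal.absNorm J then (1 : ℝ) else 0) =
      ∑ S ∈ (primesAbove p).powerset,
        (-1 : ℝ) ^ #S * (if (∏ P ∈ S, P) ∣ J then (1 : ℝ) else 0) := by
    intro J hJ
    have h1 : (if ¬ p ∣ Ideal.absNorm J then (1 : ℝ) else 0) =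
        ∏ P ∈ primesAbove p, (1 + (-1) * (if P ∣ J then (1 : ℝ) else 0)) := by
      by_cases h : p ∣ Ideal.absNorm J
      · rw [if_neg (not_not.mpr h)]
        obtain ⟨P, hP, hPJ⟩ := (dvd_absNorm_iff_exists_mem_primesAbove hp (hV J hJ)).mp h
        rw [Finset.prod_eq_zero hP (by rw [if_pos hPJ]; ring)]
      · rw [if_pos h]
        refine (Finset.prod_eq_one fun P hP => ?_).symm
        rw [if_neg (fun hPJ => h ((dvd_absNorm_iff_exists_mem_primesAbove hp (hV J hJ)).mpr
          ⟨P, hP, hPJ⟩))]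
        ring
    rw [h1, Finset.prod_one_add]
    refine Finset.sum_congr rfl fun S hS => ?_
    have hSsub : S ⊆ primesAbove p := mem_powerset.mp hS
    have hSp : ∀ P ∈ S, P.IsPrime ∧ P ≠ ⊥ := fun P hP => isPrime_of_mem_primesAbove (hSsub hP)
    rw [Finset.prod_mul_distrib, Finset.prod_const, Finset.prod_boole]
    congr 1
    by_cases hall : ∀ P ∈ S, P ∣ J
    · rw [if_pos hall, if_pos ((ideal_prod_dvd_iff_forall_dvd hSp).mpr hall)]
    · rw [if_neg hall, if_neg (fun h => hall ((ideal_prod_dvd_iff_forall_dvd hSp).mp h))]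
  rw [natCast_card_filter, Finset.sum_congr rfl key, Finset.sum_comm]
  refine Finset.sum_congr rfl fun S _ => ?_
  rw [← Finset.mul_sum, natCast_card_filter]

open scoped Classical in
/-- **Scaling**: for `D ≠ 0` with `(d, N(D)) = 1`, the ideals `J` of the window `(Y, Y(1+η)]` with
`d ∣ N(J)` and `D ∣ J` are the `D·J'` with `J'` in the window `(Y/N(D), Y(1+η)/N(D)]` and
`d ∣ N(J')`. [folklore] -/
theorem card_filter_dvd_and_dvd_eq {Y η : ℝ} {d : ℕ} {D : Ideal (𝓞 K)} (hD : D ≠ ⊥)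
    (hcop : d.Coprime (Ideal.absNorm D)) :
    #{J ∈ idealWindow Y η | d ∣ Ideal.absNorm J ∧ D ∣ J} =
      windowDvdCount (Y / Ideal.absNorm D) η d := by
  classical
  have hN0' : Ideal.absNorm D ≠ 0 := fun h => hD (Ideal.absNorm_eq_zero_iff.mp h)
  have hN0 : (0 : ℝ) < Ideal.absNorm D := by positivity
  have hD0 : (D : Ideal (𝓞 K)) ≠ 0 := by rwa [Ne, Ideal.zero_eq_bot]
  rw [windowDvdCount]
  symm
  refine Finset.card_bij (fun J' _ => D * J') (fun J' hJ' => ?_) (fun J₁ _ J₂ _ h => ?_)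
    (fun J hJ => ?_)
  · rw [mem_filter, mem_idealWindow_iff] at hJ'
    obtain ⟨⟨h1, h2⟩, hd⟩ := hJ'
    rw [mem_filter, mem_idealWindow_iff, map_mul, Nat.cast_mul]
    refine ⟨⟨?_, ?_⟩, Dvd.dvd.mul_left hd _, dvd_mul_right _ _⟩
    · rw [div_lt_iff₀ hN0] at h1; linarith
    · rw [div_mul_eq_mul_div, le_div_iff₀ hN0] at h2; linarith
  · exact mul_left_cancel₀ hD0 h
  · rw [mem_filter, mem_idealWindow_iff] at hJ
    obtain ⟨⟨h1, h2⟩, hd, ⟨J', rfl⟩⟩ := hJ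
    rw [map_mul, Nat.cast_mul] at h1 h2
    refine ⟨J', ?_, rfl⟩
    rw [mem_filter, mem_idealWindow_iff]
    refine ⟨⟨?_, ?_⟩, ?_⟩
    · rw [div_lt_iff₀ hN0]; linarith
    · rw [div_mul_eq_mul_div, le_div_iff₀ hN0]; linarith
    · rw [map_mul] at hd
      exact hcop.dvd_of_dvd_mul_left hd

/-! ### The density `g(d) = ∏_{p ∣ d} (1 − ∏_{P ∣ p} (1 − N(P)^{-1}))` of the norms -/

/-- `g(p) = 1 − ∏_{P ∣ p} (1 − N(P)^{-1})`: the density of the ideals whose norm is divisible by `p`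
(Heath-Brown's `ρ₁(p)/p`, Lemma 2.2: `ρ₁(p) = p(1 − ∏_{P∣p}(1 − N(P)^{-1}))`).
[cite: HeathBrownActa2001, Lemma 2.2] -/
def normDensityAt (p : ℕ) : ℝ :=
  1 - ∏ P ∈ primesAbove p, (1 - ((Ideal.absNorm P : ℕ) : ℝ)⁻¹)

/-- The multiplicative density `g(d) = ∏_{p ∣ d} g(p)` of the norms, `ρ₁(d)/d` on square-free `d`
(Lemma 2.2), as an arithmetic function. [cite: HeathBrownActa2001, Lemma 2.2] -/
def normDensity : ArithmeticFunction ℝ := ArithmeticFunction.prodPrimeFactors normDensityAt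

/-- `g` is multiplicative. [folklore] -/
theorem isMultiplicative_normDensity : normDensity.IsMultiplicative :=
  ArithmeticFunction.IsMultiplicative.prodPrimeFactors _

/-- `g(p) = normDensityAt p` at a prime. [folklore] -/
theorem normDensity_apply_prime {p : ℕ} (hp : p.Prime) : normDensity p = normDensityAt p := by
  rw [normDensity, ArithmeticFunction.prodPrimeFactors_apply hp.ne_zero, hp.primeFactors,
    prod_singleton]

/-- `g(1) = 1`. [folklore] -/
theorem normDensity_one : normDensity 1 = 1 := by
  rw [normDensity, ArithmeticFunction.prodPrimeFactors_apply one_ne_zero, Nat.primeFactors_one,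
    prod_empty]

/-- The one-prime expansion `g(p) = 1 − ∑_{S ⊆ 𝔓_p} (−1)^{|S|} N(∏_{P∈S} P)^{-1}`. [folklore] -/
theorem normDensityAt_eq_one_sub_sum (p : ℕ) : normDensityAt p =
    1 - ∑ S ∈ (primesAbove p).powerset,
      (-1 : ℝ) ^ #S * ((Ideal.absNorm (∏ P ∈ S, P) : ℕ) : ℝ)⁻¹ := by
  rw [normDensityAt]
  congr 1
  have h : ∀ P ∈ primesAbove p, (1 - ((Ideal.absNorm P : ℕ) : ℝ)⁻¹) =
      1 + (-1) * ((Ideal.absNorm P : ℕ) : ℝ)⁻¹ := fun _ _ => by ring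
  rw [Finset.prod_congr rfl h, Finset.prod_one_add]
  refine Finset.sum_congr rfl fun S _ => ?_
  rw [Finset.prod_mul_distrib, Finset.prod_const, map_prod, Nat.cast_prod, Finset.prod_inv_distrib]

/-! ### The Type I estimate for the norms in a window: `W(Y, η, d) = γ₀ηY g(d) + O(8^{ω(d)}(Y/d + 1)^{2/3})` -/

/-- **`#{J : Y < N(J) ≤ Y(1+η), d ∣ N(J)} = γ₀ηY·g(d) + O(8^{ω(d)} (2Y/d + 1)^{2/3})`** uniformly in
`Y ≥ 0`, `0 ≤ η ≤ 1` and square-free `d` — the form of Heath-Brown's Lemma 2.2 / (5.7)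
(`#ℬ_R^(K) = 3γ₀ηX³N(R)^{-1} + O(X²N(R)^{-2/3})`, p. 32) needed by a sieve on the norms, proved from
the Weber–Landau count by induction on `ω(d)`: splitting off `p = minFac d`, `d = p d'`,
`W(Y, d) = W(Y, d') − #{d' ∣ N(J), p ∤ N(J)} = ∑_{∅ ≠ S ⊆ 𝔓_p} (−1)^{|S|+1} W(Y/N(∏_S P), d')` by
inclusion–exclusion and the scaling `J = (∏_S P)·J'`, matched by
`g(p) = ∑_{∅ ≠ S} (−1)^{|S|+1} N(∏_S P)^{-1}`; there are `≤ 2³ − 1` such `S` and `N(∏_S P) ≥ p`.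
[cite: HeathBrownActa2001, §5 (5.7) p. 32] -/
theorem exists_windowDvdCount_sub_le :
    ∃ C : ℝ, 0 ≤ C ∧ ∀ d : ℕ, Squarefree d → ∀ Y η : ℝ, 0 ≤ Y → 0 ≤ η → η ≤ 1 →
      |(windowDvdCount Y η d : ℝ) - gamma₀ * η * Y * normDensity d| ≤
        C * 8 ^ #d.primeFactors * (2 * Y / d + 1) ^ (2 / 3 : ℝ) := by
  classical
  obtain ⟨C, hC0, hC⟩ := exists_idealCount_sub_le
  refine ⟨2 * C, by positivity, fun d => ?_⟩
  induction d using Nat.strong_induction_on with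
  | _ d ih =>
  intro hsq Y η hY hη0 hη1
  have hρ0 : 0 < gamma₀ := gamma₀_pos
  rcases eq_or_ne d 1 with rfl | hd1
  · -- base case `d = 1`
    rw [windowDvdCount_one hY hη0, normDensity_one, Nat.primeFactors_one, card_empty, pow_zero,
      mul_one, Nat.cast_one, div_one, mul_one]
    have hY2 : 0 ≤ Y * (1 + η) := by positivity
    have e1 := hC (Y * (1 + η)) hY2
    have e2 := hC Y hY
    have hm1 : (Y * (1 + η) + 1) ^ (2 / 3 : ℝ) ≤ (2 * Y + 1) ^ (2 / 3 : ℝ) :=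
      Real.rpow_le_rpow (by positivity) (by nlinarith) (by norm_num)
    have hm2 : (Y + 1) ^ (2 / 3 : ℝ) ≤ (2 * Y + 1) ^ (2 / 3 : ℝ) :=
      Real.rpow_le_rpow (by positivity) (by linarith) (by norm_num)
    have hsplit : (idealCount K (Y * (1 + η)) : ℝ) - idealCount K Y - gamma₀ * η * Y =
        ((idealCount K (Y * (1 + η)) : ℝ) - gamma₀ * (Y * (1 + η))) -
          ((idealCount K Y : ℝ) - gamma₀ * Y) := by ring
    rw [hsplit]
    calc |((idealCount K (Y * (1 + η)) : ℝ) - gamma₀ * (Y * (1 + η))) -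
          ((idealCount K Y : ℝ) - gamma₀ * Y)|
        ≤ |(idealCount K (Y * (1 + η)) : ℝ) - gamma₀ * (Y * (1 + η))| +
            |(idealCount K Y : ℝ) - gamma₀ * Y| := abs_sub _ _
      _ ≤ C * (Y * (1 + η) + 1) ^ (2 / 3 : ℝ) + C * (Y + 1) ^ (2 / 3 : ℝ) := add_le_add e1 e2
      _ ≤ C * (2 * Y + 1) ^ (2 / 3 : ℝ) + C * (2 * Y + 1) ^ (2 / 3 : ℝ) := by gcongr
      _ = 2 * C * (2 * Y + 1) ^ (2 / 3 : ℝ) := by ring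
  · -- induction step: split off `p = minFac d`
    have hd0 : d ≠ 0 := hsq.ne_zero
    set p := d.minFac with hpdef
    have hp : p.Prime := Nat.minFac_prime hd1
    have hpd : p ∣ d := Nat.minFac_dvd d
    obtain ⟨d', hdd'⟩ := hpd
    have hd'0 : d' ≠ 0 := by rintro rfl; exact hd0 (by rw [hdd', mul_zero])
    have hpd' : ¬ p ∣ d' := by
      rintro ⟨e, rfl⟩
      have : p * p ∣ d := ⟨e, by rw [hdd']; ring⟩
      exact hp.ne_one (Nat.isUnit_iff.mp (hsq p this))
    have hcop : p.Coprime d' := (Nat.Prime.coprime_iff_not_dvd hp).mpr hpd'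
    have hd'lt : d' < d := by
      rw [hdd']; exact lt_mul_left (Nat.pos_of_ne_zero hd'0) hp.one_lt
    have hsq' : Squarefree d' := Squarefree.squarefree_of_dvd (⟨p, by rw [hdd', mul_comm]⟩ : d' ∣ d) hsq
    have ih' := ih d' hd'lt hsq'
    -- prime factors and the density
    have hpf : d.primeFactors = insert p d'.primeFactors := by
      rw [hdd', Nat.primeFactors_mul hp.ne_zero hd'0, hp.primeFactors, Finset.insert_eq]
    have hpnot : p ∉ d'.primeFactors := fun h => hpd' (Nat.dvd_of_mem_primeFactors h)
    have hcardpf : #d.primeFactors = #d'.primeFactors + 1 := by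
      rw [hpf, card_insert_of_notMem hpnot]
    have hgd : normDensity d = normDensityAt p * normDensity d' := by
      rw [hdd', isMultiplicative_normDensity.map_mul_of_coprime hcop, normDensity_apply_prime hp]
    -- the window sets
    have hne : ∀ J ∈ idealWindow Y η, J ≠ ⊥ := fun J hJ => ne_bot_of_mem_idealWindow hY hJ
    set V : Finset (Ideal (𝓞 K)) := {J ∈ idealWindow Y η | d' ∣ Ideal.absNorm J} with hVdef
    have hVne : ∀ J ∈ V, J ≠ ⊥ := fun J hJ => hne J (mem_filter.mp hJ).1
    -- `W(Y, d) = #V − #{J ∈ V : p ∤ N(J)}`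
    have hWd : (windowDvdCount Y η d : ℝ) = windowDvdCount Y η d' - #{J ∈ V | ¬ p ∣ Ideal.absNorm J} := by
      have h1 : windowDvdCount Y η d = #{J ∈ V | p ∣ Ideal.absNorm J} := by
        rw [windowDvdCount, hVdef, filter_filter]
        congr 1
        refine filter_congr fun J _ => ?_
        rw [hdd']
        constructor
        · intro h
          exact ⟨(dvd_mul_left d' p).trans h, (dvd_mul_right p d').trans h⟩
        · rintro ⟨h1, h2⟩
          exact hcop.mul_dvd_of_dvd_of_dvd h2 h1
      have h2 : windowDvdCount Y η d' = #V := rfl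
      have h3 := Finset.card_filter_add_card_filter_not (s := V) (fun J => p ∣ Ideal.absNorm J)
      rw [h1, h2, ← h3, Nat.cast_add]
      ring
    -- inclusion–exclusion and scaling
    have hIE := card_filter_not_dvd_absNorm_eq_sum hp V hVne
    have hscale : ∀ S ∈ (primesAbove p).powerset,
        (#{J ∈ V | (∏ P ∈ S, P) ∣ J} : ℝ) =
          windowDvdCount (Y / Ideal.absNorm (∏ P ∈ S, P)) η d' := by
      intro S hS
      have hSsub : S ⊆ primesAbove p := mem_powerset.mp hS
      obtain ⟨m, hm, -⟩ := absNorm_prod_primesAbove hp hSsub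
      have hcop' : d'.Coprime (Ideal.absNorm (∏ P ∈ S, P)) := by
        rw [hm]; exact (hcop.symm).pow_right m
      rw [← card_filter_dvd_and_dvd_eq (prod_primesAbove_ne_bot hSsub) hcop', hVdef, filter_filter]
    -- the `S = ∅` terms
    have h0mem : (∅ : Finset (Ideal (𝓞 K))) ∈ (primesAbove p).powerset := empty_mem_powerset _
    -- assemble the exact identity for the remainder
    set T : Finset (Ideal (𝓞 K)) → ℝ := fun S =>
      (windowDvdCount (Y / Ideal.absNorm (∏ P ∈ S, P)) η d' : ℝ) -
        gamma₀ * η * (Y / Ideal.absNorm (∏ P ∈ S, P)) * normDensity d' with hTdef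
    have hident : (windowDvdCount Y η d : ℝ) - gamma₀ * η * Y * normDensity d =
        -∑ S ∈ (primesAbove p).powerset.erase ∅, (-1 : ℝ) ^ #S * T S := by
      have hsum : ∑ S ∈ (primesAbove p).powerset, (-1 : ℝ) ^ #S * T S =
          T ∅ + ∑ S ∈ (primesAbove p).powerset.erase ∅, (-1 : ℝ) ^ #S * T S := by
        rw [← Finset.add_sum_erase _ _ h0mem, card_empty, pow_zero, one_mul]
      have hT0 : T ∅ = (windowDvdCount Y η d' : ℝ) - gamma₀ * η * Y * normDensity d' := by
        simp only [hTdef, prod_empty, map_one, Nat.cast_one, div_one]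
      have hexpand : ∑ S ∈ (primesAbove p).powerset, (-1 : ℝ) ^ #S * T S =
          (∑ S ∈ (primesAbove p).powerset, (-1 : ℝ) ^ #S *
              (windowDvdCount (Y / Ideal.absNorm (∏ P ∈ S, P)) η d' : ℝ)) -
            gamma₀ * η * Y * normDensity d' *
              ∑ S ∈ (primesAbove p).powerset,
                (-1 : ℝ) ^ #S * ((Ideal.absNorm (∏ P ∈ S, P) : ℕ) : ℝ)⁻¹ := by
        rw [Finset.mul_sum, ← Finset.sum_sub_distrib]
        refine Finset.sum_congr rfl fun S _ => ?_
        simp only [hTdef]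
        ring
      have hIE' : (#{J ∈ V | ¬ p ∣ Ideal.absNorm J} : ℝ) =
          ∑ S ∈ (primesAbove p).powerset, (-1 : ℝ) ^ #S *
            (windowDvdCount (Y / Ideal.absNorm (∏ P ∈ S, P)) η d' : ℝ) := by
        rw [hIE]
        exact Finset.sum_congr rfl fun S hS => by rw [hscale S hS]
      rw [hgd, normDensityAt_eq_one_sub_sum, hWd, hIE']
      linear_combination -hsum - hT0 + hexpand
    -- bound each term with `S ≠ ∅` by the induction hypothesis
    have hterm : ∀ S ∈ (primesAbove p).powerset.erase ∅,
        |(-1 : ℝ) ^ #S * T S| ≤ 2 * C * 8 ^ #d'.primeFactors * (2 * Y / d + 1) ^ (2 / 3 : ℝ) := by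
      intro S hS
      obtain ⟨hSne, hS'⟩ := Finset.mem_erase.mp hS
      have hSsub : S ⊆ primesAbove p := mem_powerset.mp hS'
      have hSnonempty : S.Nonempty := Finset.nonempty_iff_ne_empty.mpr hSne
      obtain ⟨m, hm, hmpos⟩ := absNorm_prod_primesAbove hp hSsub
      have hm1 : 0 < m := hmpos hSnonempty
      have hNpos : (0 : ℝ) < Ideal.absNorm (∏ P ∈ S, P) := by
        rw [hm]; exact_mod_cast pow_pos hp.pos m
      have hNge : (p : ℝ) ≤ Ideal.absNorm (∏ P ∈ S, P) := by
        rw [hm]; exact_mod_cast Nat.le_self_pow hm1.ne' p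
      rw [abs_mul, abs_pow, abs_neg, abs_one, one_pow, one_mul]
      have hY' : 0 ≤ Y / Ideal.absNorm (∏ P ∈ S, P) := by positivity
      have h := ih' (Y / Ideal.absNorm (∏ P ∈ S, P)) η hY' hη0 hη1
      simp only [hTdef]
      refine h.trans ?_
      have hp0 : (0 : ℝ) < p := by exact_mod_cast hp.pos
      have hd'pos : (0 : ℝ) < d' := by exact_mod_cast Nat.pos_of_ne_zero hd'0
      have hmono : 2 * (Y / Ideal.absNorm (∏ P ∈ S, P)) / d' + 1 ≤ 2 * Y / d + 1 := by
        rw [hdd', Nat.cast_mul, ← mul_div_assoc, div_div]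
        gcongr ?_ + 1
        exact div_le_div_of_nonneg_left (by positivity) (by positivity) (by gcongr)
      gcongr
    -- the number of nonempty `S` is at most `2³ − 1 ≤ 7`
    have hcardS : (#((primesAbove p).powerset.erase ∅) : ℝ) ≤ 7 := by
      have h1 : #((primesAbove p).powerset.erase ∅) = 2 ^ #(primesAbove p) - 1 := by
        rw [card_erase_of_mem h0mem, card_powerset]
      have h2 : 2 ^ #(primesAbove p) ≤ 2 ^ 3 := Nat.pow_le_pow_right two_pos (card_primesAbove_le hp)
      rw [h1]
      have : 2 ^ #(primesAbove p) - 1 ≤ 7 := by omega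
      exact_mod_cast this
    rw [hident, abs_neg]
    calc |∑ S ∈ (primesAbove p).powerset.erase ∅, (-1 : ℝ) ^ #S * T S|
        ≤ ∑ S ∈ (primesAbove p).powerset.erase ∅, |(-1 : ℝ) ^ #S * T S| := abs_sum_le_sum_abs _ _
      _ ≤ ∑ S ∈ (primesAbove p).powerset.erase ∅,
            2 * C * 8 ^ #d'.primeFactors * (2 * Y / d + 1) ^ (2 / 3 : ℝ) := sum_le_sum hterm
      _ = #((primesAbove p).powerset.erase ∅) *
            (2 * C * 8 ^ #d'.primeFactors * (2 * Y / d + 1) ^ (2 / 3 : ℝ)) := by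
          rw [sum_const, nsmul_eq_mul]
      _ ≤ 7 * (2 * C * 8 ^ #d'.primeFactors * (2 * Y / d + 1) ^ (2 / 3 : ℝ)) := by
          gcongr
      _ ≤ 2 * C * 8 ^ #d.primeFactors * (2 * Y / d + 1) ^ (2 / 3 : ℝ) := by
          rw [hcardpf, pow_succ]
          have : 0 ≤ 2 * C * 8 ^ #d'.primeFactors * (2 * Y / d + 1) ^ (2 / 3 : ℝ) := by positivity
          nlinarith

/-! ### Bounds for the density: `0 ≤ g(p) < 1`, sieve dimension (crudely `3`), and `V(z) ≪ 1/log z` -/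

/-- The factors `1 − N(P)^{-1}` lie in `[1/2, 1]`. [folklore] -/
theorem one_sub_inv_absNorm_mem {p : ℕ} (hp : p.Prime) {P : Ideal (𝓞 K)} (hP : P ∈ primesAbove p) :
    1 - (p : ℝ)⁻¹ ≤ 1 - ((Ideal.absNorm P : ℕ) : ℝ)⁻¹ ∧ (1 : ℝ) / 2 ≤ 1 - (p : ℝ)⁻¹ ∧
      1 - ((Ideal.absNorm P : ℕ) : ℝ)⁻¹ ≤ 1 := by
  have hp2 : (2 : ℝ) ≤ p := by exact_mod_cast hp.two_le
  have hpN : (p : ℝ) ≤ Ideal.absNorm P := by exact_mod_cast le_absNorm_of_mem_primesAbove hp hP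
  have hp0 : (0 : ℝ) < p := by linarith
  refine ⟨?_, ?_, ?_⟩
  · have : ((Ideal.absNorm P : ℕ) : ℝ)⁻¹ ≤ (p : ℝ)⁻¹ := inv_anti₀ hp0 hpN
    linarith
  · have : (p : ℝ)⁻¹ ≤ 1 / 2 := by
      rw [inv_eq_one_div]; exact div_le_div_of_nonneg_left zero_le_one two_pos hp2
    linarith
  · have : 0 ≤ ((Ideal.absNorm P : ℕ) : ℝ)⁻¹ := by positivity
    linarith

/-- `(1 − 1/p)³ ≤ 1 − g(p) = ∏_{P ∣ p} (1 − N(P)^{-1}) ≤ 1`, and `1 − g(p) > 0`. [folklore] -/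
theorem one_sub_normDensityAt_bounds {p : ℕ} (hp : p.Prime) :
    (1 - (p : ℝ)⁻¹) ^ 3 ≤ 1 - normDensityAt p ∧ 0 < 1 - normDensityAt p ∧
      1 - normDensityAt p ≤ 1 := by
  have hsub : 1 - normDensityAt p = ∏ P ∈ primesAbove p, (1 - ((Ideal.absNorm P : ℕ) : ℝ)⁻¹) := by
    rw [normDensityAt]; ring
  rw [hsub]
  have hp2 : (2 : ℝ) ≤ p := by exact_mod_cast hp.two_le
  have hq0 : (0 : ℝ) < 1 - (p : ℝ)⁻¹ := by
    have : (p : ℝ)⁻¹ ≤ 1 / 2 := by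
      rw [inv_eq_one_div]; exact div_le_div_of_nonneg_left zero_le_one two_pos hp2
    linarith
  have hq1 : 1 - (p : ℝ)⁻¹ ≤ 1 := by
    have : (0 : ℝ) ≤ (p : ℝ)⁻¹ := by positivity
    linarith
  refine ⟨?_, ?_, ?_⟩
  · calc (1 - (p : ℝ)⁻¹) ^ 3 ≤ (1 - (p : ℝ)⁻¹) ^ #(primesAbove p) :=
          pow_le_pow_of_le_one hq0.le hq1 (card_primesAbove_le hp)
      _ = ∏ P ∈ primesAbove p, (1 - (p : ℝ)⁻¹) := by rw [prod_const]
      _ ≤ ∏ P ∈ primesAbove p, (1 - ((Ideal.absNorm P : ℕ) : ℝ)⁻¹) :=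
          prod_le_prod (fun P _ => hq0.le) fun P hP => (one_sub_inv_absNorm_mem hp hP).1
  · exact prod_pos fun P hP => by
      linarith [(one_sub_inv_absNorm_mem hp hP).1, (one_sub_inv_absNorm_mem hp hP).2.1]
  · exact prod_le_one (fun P hP => by
      linarith [(one_sub_inv_absNorm_mem hp hP).1, (one_sub_inv_absNorm_mem hp hP).2.1])
      fun P hP => (one_sub_inv_absNorm_mem hp hP).2.2

/-- `0 ≤ g(p) < 1`. [folklore] -/
theorem normDensityAt_nonneg_lt_one {p : ℕ} (hp : p.Prime) :
    0 ≤ normDensityAt p ∧ normDensityAt p < 1 := by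
  obtain ⟨-, h0, h1⟩ := one_sub_normDensityAt_bounds hp
  exact ⟨by linarith, by linarith⟩

/-- `(1 − 1/p)⁻¹ ≤ exp(1/p + 1/(p(p−1)))` for real `p ≥ 2` (`= 1 + 1/(p−1)`). [folklore] -/
theorem inv_one_sub_inv_le_exp {p : ℝ} (hp : 2 ≤ p) :
    (1 - p⁻¹)⁻¹ ≤ Real.exp (1 / p + 1 / (p * (p - 1))) := by
  have hp0 : 0 < p := by linarith
  have hp1 : 0 < p - 1 := by linarith
  have e1 : (1 - p⁻¹)⁻¹ = 1 / (p - 1) + 1 := by field_simp; ring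
  have e2 : 1 / p + 1 / (p * (p - 1)) = 1 / (p - 1) := by field_simp; ring
  rw [e1, e2]
  exact Real.add_one_le_exp _

/-- **The density of the norms has sieve dimension (at most) `3`**, with an absolute constant:
`0 ≤ g(p) < 1` and `∏_{w ≤ p < z} (1 − g(p))⁻¹ ≤ K₃ (log z/log w)³` for `2 ≤ w ≤ z`, from
`(1 − g(p))⁻¹ ≤ (1 − 1/p)⁻³ ≤ exp(3/p + 3/(p(p−1)))` and Mertens over the window
(`sum_primesWindow_one_div_le`). (The true dimension is `1`, by the prime ideal theorem; the crude
value only affects constants.) [folklore] -/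
theorem hasSieveDimension_normDensity :
    HasSieveDimension normDensity 3 (Real.exp (3 * (9 / 2 + 6 / Real.log 2) + 3)) := by
  refine ⟨fun p hp => ?_, fun w z hw hwz => ?_⟩
  · rw [normDensity_apply_prime hp]; exact normDensityAt_nonneg_lt_one hp
  set S := (Nat.primesBelow ⌈z⌉₊).filter (fun p : ℕ => w ≤ (p : ℝ)) with hS
  have hlogw : 0 < Real.log w := Real.log_pos (by linarith)
  have hlogz : 0 < Real.log z := Real.log_pos (by linarith)
  have hmemS : ∀ p ∈ S, p.Prime ∧ w ≤ (p : ℝ) ∧ p ≤ ⌊z⌋₊ := by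
    intro p hp
    rw [hS, Finset.mem_filter, Nat.mem_primesBelow] at hp
    exact ⟨hp.1.2, hp.2, Nat.le_floor (Nat.lt_ceil.mp hp.1.1).le⟩
  have hSle : S ⊆ Nat.primesLE ⌊z⌋₊ := fun p hp =>
    Nat.mem_primesLE.mpr ⟨(hmemS p hp).2.2, (hmemS p hp).1⟩
  set F : ℕ → ℝ := fun p => Real.exp (3 * (1 / (p : ℝ)) + 3 * (1 / ((p : ℝ) * ((p : ℝ) - 1))))
    with hF
  have hpt : ∀ p ∈ S, (1 - normDensity p)⁻¹ ≤ F p := by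
    intro p hp
    have hpp := (hmemS p hp).1
    have hp2 : (2 : ℝ) ≤ p := by exact_mod_cast hpp.two_le
    rw [normDensity_apply_prime hpp]
    obtain ⟨h3, h0, -⟩ := one_sub_normDensityAt_bounds hpp
    have hq0 : (0 : ℝ) < 1 - (p : ℝ)⁻¹ := by
      have : (p : ℝ)⁻¹ ≤ 1 / 2 := by
        rw [inv_eq_one_div]; exact div_le_div_of_nonneg_left zero_le_one two_pos hp2
      linarith
    calc (1 - normDensityAt p)⁻¹ ≤ ((1 - (p : ℝ)⁻¹) ^ 3)⁻¹ := inv_anti₀ (pow_pos hq0 3) h3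
      _ = ((1 - (p : ℝ)⁻¹)⁻¹) ^ 3 := by rw [inv_pow]
      _ ≤ (Real.exp (1 / p + 1 / (p * (p - 1)))) ^ 3 :=
          pow_le_pow_left₀ (inv_nonneg.mpr hq0.le) (inv_one_sub_inv_le_exp hp2) 3
      _ = F p := by
          rw [hF, ← Real.exp_nat_mul]
          congr 1
          push_cast
          ring
  have hnonneg : ∀ p ∈ S, 0 ≤ (1 - normDensity p)⁻¹ := fun p hp => by
    rw [normDensity_apply_prime (hmemS p hp).1]
    exact inv_nonneg.mpr (one_sub_normDensityAt_bounds (hmemS p hp).1).2.1.le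
  have hsum1 : ∑ p ∈ S, (1 : ℝ) / p ≤
      Real.log (Real.log z) - Real.log (Real.log w) + (9 / 2 + 6 / Real.log 2) :=
    sum_primesWindow_one_div_le hw hwz
  have hsum2 : ∑ p ∈ S, (1 : ℝ) / (p * (p - 1)) ≤ 1 :=
    (Finset.sum_le_sum_of_subset_of_nonneg hSle fun p hp _ => by
      have hp2 : (2 : ℝ) ≤ p := by exact_mod_cast (Nat.mem_primesLE.mp hp).2.two_le
      have : (0 : ℝ) < p * (p - 1) := mul_pos (by linarith) (by linarith)
      positivity).trans
      (Literature.NumberTheory.LFunctions.MertensBound.sum_inv_prime_mul_pred_le_one ⌊z⌋₊)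
  have hE : Real.exp (Real.log (Real.log z) - Real.log (Real.log w)) = Real.log z / Real.log w := by
    rw [Real.exp_sub, Real.exp_log hlogz, Real.exp_log hlogw]
  calc ∏ p ∈ S, (1 - normDensity p)⁻¹ ≤ ∏ p ∈ S, F p := Finset.prod_le_prod hnonneg hpt
    _ = Real.exp (∑ p ∈ S, (3 * (1 / (p : ℝ)) + 3 * (1 / ((p : ℝ) * ((p : ℝ) - 1))))) := by
        rw [hF, Real.exp_sum]
    _ = Real.exp (3 * ∑ p ∈ S, 1 / (p : ℝ) + 3 * ∑ p ∈ S, 1 / ((p : ℝ) * ((p : ℝ) - 1))) := by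
        rw [Finset.sum_add_distrib, Finset.mul_sum, Finset.mul_sum]
    _ ≤ Real.exp (3 * (Real.log (Real.log z) - Real.log (Real.log w) + (9 / 2 + 6 / Real.log 2)) +
          3 * 1) := Real.exp_le_exp.mpr (by linarith)
    _ = Real.exp ((3 * (9 / 2 + 6 / Real.log 2) + 3) +
          3 * (Real.log (Real.log z) - Real.log (Real.log w))) := by congr 1; ring
    _ = Real.exp (3 * (9 / 2 + 6 / Real.log 2) + 3) * (Real.log z / Real.log w) ^ (3 : ℝ) := by
        rw [Real.exp_add, ← hE, ← Real.exp_mul, mul_comm (Real.log (Real.log z) - _) 3]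

/-- The number of prime ideals of norm `p` among the primes above `p` is `c_K(p)`
(`Literature.NumberTheory.LFunctions.idealNormCount`: every ideal of prime norm `p` is a prime above `p`). [folklore] -/
theorem card_filter_absNorm_eq_prime {p : ℕ} (hp : p.Prime) :
    #{P ∈ primesAbove p | Ideal.absNorm P = p} = idealNormCount K p := by
  classical
  unfold Literature.NumberTheory.LFunctions.idealNormCount
  rw [← Set.ncard_coe_finset, ← Nat.card_coe_set_eq]
  refine (Nat.card_congr (Equiv.subtypeEquivRight fun I => ?_))
  rw [Finset.mem_coe, mem_filter, mem_primesAbove_iff hp]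
  constructor
  · exact fun h => h.2
  · intro h
    have hI0 : I ≠ ⊥ := fun h0 => hp.ne_zero (by rw [← h, h0, Ideal.absNorm_bot])
    exact ⟨⟨Ideal.isPrime_of_irreducible_absNorm (h ▸ hp.prime.irreducible), hI0, h ▸ dvd_rfl⟩, h⟩

/-- `(1 − x)^m ≤ 1 − m x + 3x²` for `0 ≤ x` and `m ≤ 3`. [folklore] -/
theorem one_sub_pow_le_of_le_three {x : ℝ} (hx0 : 0 ≤ x) {m : ℕ} (hm : m ≤ 3) :
    (1 - x) ^ m ≤ 1 - m * x + 3 * x ^ 2 := by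
  interval_cases m
  · simp only [pow_zero, Nat.cast_zero, zero_mul, sub_zero]; nlinarith
  · simp only [pow_one, Nat.cast_one, one_mul]; nlinarith
  · push_cast; nlinarith
  · push_cast; nlinarith [pow_nonneg hx0 3, mul_nonneg hx0 (mul_nonneg hx0 hx0)]

/-- **`g(p) ≥ c_K(p)/p − 3/p²`**: only the `c_K(p) ≤ 3` primes of norm exactly `p` matter for the
main term. [folklore] -/
theorem idealNormCount_div_sub_le_normDensityAt {p : ℕ} (hp : p.Prime) :
    (idealNormCount K p : ℝ) / p - 3 / (p : ℝ) ^ 2 ≤ normDensityAt p := by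
  classical
  set T := {P ∈ primesAbove p | Ideal.absNorm P = p} with hT
  have hTsub : T ⊆ primesAbove p := filter_subset _ _
  have hp0 : (0 : ℝ) < p := by exact_mod_cast hp.pos
  have hx0 : (0 : ℝ) ≤ (p : ℝ)⁻¹ := by positivity
  have hprod : ∏ P ∈ primesAbove p, (1 - ((Ideal.absNorm P : ℕ) : ℝ)⁻¹) ≤
      (1 - (p : ℝ)⁻¹) ^ #T := by
    rw [← Finset.prod_sdiff hTsub]
    have h1 : ∏ P ∈ primesAbove p \ T, (1 - ((Ideal.absNorm P : ℕ) : ℝ)⁻¹) ≤ 1 :=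
      prod_le_one (fun P hP => by
        have hP := (mem_sdiff.mp hP).1
        linarith [(one_sub_inv_absNorm_mem hp hP).1, (one_sub_inv_absNorm_mem hp hP).2.1])
        fun P hP => (one_sub_inv_absNorm_mem hp (mem_sdiff.mp hP).1).2.2
    have h2 : ∏ P ∈ T, (1 - ((Ideal.absNorm P : ℕ) : ℝ)⁻¹) = (1 - (p : ℝ)⁻¹) ^ #T := by
      rw [← prod_const]
      exact prod_congr rfl fun P hP => by rw [(mem_filter.mp hP).2]
    have h3 : 0 ≤ ∏ P ∈ T, (1 - ((Ideal.absNorm P : ℕ) : ℝ)⁻¹) :=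
      prod_nonneg fun P hP => by
        have hP := hTsub hP
        linarith [(one_sub_inv_absNorm_mem hp hP).1, (one_sub_inv_absNorm_mem hp hP).2.1]
    rw [← h2]
    exact mul_le_of_le_one_left h3 h1
  have hcard : #T = idealNormCount K p := card_filter_absNorm_eq_prime hp
  have hcard3 : idealNormCount K p ≤ 3 := hcard ▸ (card_le_card hTsub).trans (card_primesAbove_le hp)
  have hbern := one_sub_pow_le_of_le_three hx0 hcard3
  rw [normDensityAt]
  rw [hcard] at hprod
  have : (idealNormCount K p : ℝ) / p - 3 / (p : ℝ) ^ 2 =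
      1 - (1 - (idealNormCount K p : ℝ) * (p : ℝ)⁻¹ + 3 * ((p : ℝ)⁻¹) ^ 2) := by
    field_simp
    ring
  rw [this]
  linarith

/-- **`V(z) = ∏_{p<z} (1 − g(p)) ≤ K_V/log z`** for `z ≥ 2`: Mertens' theorem for the degree-one primes
of `K` (`sum_primesLE_idealNormCount_div_eq`, from the prime ideal theorem proved in the tree) and
`g(p) ≥ c_K(p)/p − 3/p²`. [folklore] -/
theorem exists_prod_one_sub_normDensityAt_le :
    ∃ Kv : ℝ, 0 < Kv ∧ ∀ z : ℝ, 2 ≤ z →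
      ∏ p ∈ Nat.primesBelow ⌈z⌉₊, (1 - normDensityAt p) ≤ Kv / Real.log z := by
  obtain ⟨c, C, hM⟩ :=
    Literature.NumberTheory.LFunctions.NumberField.sum_primesLE_idealNormCount_div_eq (K := K) 0
  have hl2 : 0 < Real.log 2 := Real.log_pos one_lt_two
  have hC0 : 0 ≤ C := by
    have h := hM 2 le_rfl
    rw [zero_add, pow_one] at h
    by_contra hneg
    have : C / Real.log 2 < 0 := div_neg_of_neg_of_pos (not_le.mp hneg) hl2
    linarith [abs_nonneg (∑ p ∈ Nat.primesLE ⌊(2 : ℝ)⌋₊, (idealNormCount K p : ℝ) / p -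
      (Real.log (Real.log 2) + c))]
  set B : ℝ := Real.log 2 - c + C / Real.log 2 + 3 with hB
  refine ⟨max (Real.exp B) (Real.log 4), lt_max_of_lt_left (Real.exp_pos _), fun z hz => ?_⟩
  have hlogz : 0 < Real.log z := Real.log_pos (by linarith)
  have hfac : ∀ p ∈ Nat.primesBelow ⌈z⌉₊, 0 ≤ 1 - normDensityAt p ∧ 1 - normDensityAt p ≤ 1 := by
    intro p hp
    obtain ⟨-, h0, h1⟩ := one_sub_normDensityAt_bounds (Nat.prime_of_mem_primesBelow hp)
    exact ⟨h0.le, h1⟩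
  have hprod1 : ∏ p ∈ Nat.primesBelow ⌈z⌉₊, (1 - normDensityAt p) ≤ 1 :=
    prod_le_one (fun p hp => (hfac p hp).1) fun p hp => (hfac p hp).2
  rcases lt_or_ge z 4 with hz4 | hz4
  · calc ∏ p ∈ Nat.primesBelow ⌈z⌉₊, (1 - normDensityAt p) ≤ 1 := hprod1
      _ ≤ Real.log 4 / Real.log z := by
          rw [le_div_iff₀ hlogz, one_mul]
          exact Real.log_le_log (by linarith) hz4.le
      _ ≤ max (Real.exp B) (Real.log 4) / Real.log z := by
          gcongr; exact le_max_right _ _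
  · -- `z ≥ 4`: compare with `∑_{p ≤ n} c_K(p)/p`, `n = ⌈z⌉ − 1`
    set n : ℕ := ⌈z⌉₊ - 1 with hn
    have hceil1 : 1 ≤ ⌈z⌉₊ := Nat.one_le_iff_ne_zero.mpr (Nat.ceil_pos.mpr (by linarith)).ne'
    have hn1 : ⌈z⌉₊ = n + 1 := by rw [hn]; omega
    have hnz : z - 1 ≤ n := by
      have h1 : (n : ℝ) = ⌈z⌉₊ - 1 := by
        rw [hn, Nat.cast_sub hceil1, Nat.cast_one]
      rw [h1]; linarith [Nat.le_ceil z]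
    have hn3 : (3 : ℝ) ≤ n := by linarith
    have hn2 : (2 : ℝ) ≤ n := by linarith
    have hPB : Nat.primesBelow ⌈z⌉₊ = Nat.primesLE n := by rw [hn1]; rfl
    rw [hPB]
    -- each factor `≤ exp(−g(p))`
    have h1 : ∏ p ∈ Nat.primesLE n, (1 - normDensityAt p) ≤
        Real.exp (-(∑ p ∈ Nat.primesLE n, normDensityAt p)) := by
      rw [← Finset.sum_neg_distrib, Real.exp_sum]
      refine prod_le_prod (fun p hp => ?_) fun p hp => ?_
      · exact (one_sub_normDensityAt_bounds (Nat.mem_primesLE.mp hp).2).2.1.le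
      · linarith [Real.add_one_le_exp (-(normDensityAt p))]
    -- lower bound for the sum of the densities
    have h2 : ∑ p ∈ Nat.primesLE n, ((idealNormCount K p : ℝ) / p - 3 / (p : ℝ) ^ 2) ≤
        ∑ p ∈ Nat.primesLE n, normDensityAt p :=
      sum_le_sum fun p hp => idealNormCount_div_sub_le_normDensityAt (Nat.mem_primesLE.mp hp).2
    have h3 : ∑ p ∈ Nat.primesLE n, (3 : ℝ) / (p : ℝ) ^ 2 ≤ 3 := by
      have h := Literature.NumberTheory.LFunctions.MertensBound.sum_inv_prime_mul_pred_le_one n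
      have hle : ∑ p ∈ Nat.primesLE n, (3 : ℝ) / (p : ℝ) ^ 2 ≤
          ∑ p ∈ Nat.primesLE n, 3 * (1 / ((p : ℝ) * ((p : ℝ) - 1))) := by
        refine sum_le_sum fun p hp => ?_
        have hp2 : (2 : ℝ) ≤ p := by exact_mod_cast (Nat.mem_primesLE.mp hp).2.two_le
        have hpos : (0 : ℝ) < p * (p - 1) := mul_pos (by linarith) (by linarith)
        have hle1 : (1 : ℝ) / (p : ℝ) ^ 2 ≤ 1 / ((p : ℝ) * ((p : ℝ) - 1)) :=
          div_le_div_of_nonneg_left zero_le_one hpos (by nlinarith)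
        calc (3 : ℝ) / (p : ℝ) ^ 2 = 3 * (1 / (p : ℝ) ^ 2) := by ring
          _ ≤ 3 * (1 / ((p : ℝ) * ((p : ℝ) - 1))) := by gcongr
      rw [← mul_sum] at hle
      linarith
    have h4 := hM n hn2
    rw [Nat.floor_natCast, zero_add, pow_one] at h4
    have hlogn : Real.log 2 ≤ Real.log n := Real.log_le_log two_pos hn2
    have hlogn0 : 0 < Real.log n := hl2.trans_le hlogn
    have hCn : C / Real.log n ≤ C / Real.log 2 := div_le_div_of_nonneg_left hC0 hl2 hlogn
    have h5 : Real.log (Real.log n) + c - C / Real.log 2 ≤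
        ∑ p ∈ Nat.primesLE n, (idealNormCount K p : ℝ) / p := by
      have := (abs_le.mp h4).1
      linarith
    -- `log log n ≥ log log z − log 2`
    have h6 : Real.log (Real.log z) - Real.log 2 ≤ Real.log (Real.log n) := by
      have hz0 : 0 < z := by linarith
      have hnz2 : z / 2 ≤ n := by linarith
      have hlog4 : Real.log 4 = 2 * Real.log 2 := by
        rw [show (4 : ℝ) = 2 ^ 2 by norm_num, Real.log_pow]; push_cast; ring
      have hlz2 : 2 * Real.log 2 ≤ Real.log z := by
        rw [← hlog4]; exact Real.log_le_log (by norm_num) hz4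
      have hln : Real.log z - Real.log 2 ≤ Real.log n := by
        rw [← Real.log_div hz0.ne' two_ne_zero]
        exact Real.log_le_log (by positivity) hnz2
      have hhalf : Real.log z / 2 ≤ Real.log n := by linarith
      calc Real.log (Real.log z) - Real.log 2 = Real.log (Real.log z / 2) := by
            rw [Real.log_div hlogz.ne' two_ne_zero]
        _ ≤ Real.log (Real.log n) := Real.log_le_log (by positivity) hhalf
    have h7 : Real.log (Real.log z) - B ≤ ∑ p ∈ Nat.primesLE n, normDensityAt p := by
      rw [sum_sub_distrib] at h2
      rw [hB]
      linarith
    calc ∏ p ∈ Nat.primesLE n, (1 - normDensityAt p)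
        ≤ Real.exp (-(∑ p ∈ Nat.primesLE n, normDensityAt p)) := h1
      _ ≤ Real.exp (-(Real.log (Real.log z) - B)) := Real.exp_le_exp.mpr (by linarith)
      _ = Real.exp B / Real.log z := by
          rw [neg_sub, Real.exp_sub, Real.exp_log hlogz]
      _ ≤ max (Real.exp B) (Real.log 4) / Real.log z := by
          gcongr; exact le_max_left _ _

/-! ### The sifted sequence of the norms of the ideals in a window -/

/-- The multiset of norms of the ideals `J'` with `Y < N(J') ≤ Y(1+η)` as a sifted sequence in the
sense of the tree's `SieveSequence`: `a_n = #{J' : N(J') = n}` on the window, expected size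
`γ₀ηY`, density `g` (`normDensity`). For `Y = 3X³/q` this is Heath-Brown's `ℬ` localised at the
multiples of an ideal `Q` of norm `q` ((6.4), p. 35: the passage from `S_K(ℬ^(K)_Q, z)` to sieving
the norms by rational primes). [cite: HeathBrownActa2001, §6 (6.4)] -/
def windowSeq (Y η : ℝ) : SieveSequence where
  a n := (#{J ∈ idealWindow Y η | Ideal.absNorm J = n} : ℝ)
  a_nonneg _ := Nat.cast_nonneg _
  size _ := gamma₀ * η * Y
  density := normDensity
  density_mult := isMultiplicative_normDensity

/-- Dictionary: sums of `a_n` over `n ≤ x` with a condition on `n` count the ideals of the window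
whose norm satisfies the condition (for `x ≥ Y(1+η)`, `Y ≥ 0`). [folklore] -/
theorem windowSeq_sum_filter_eq_card {Y η : ℝ} (hY : 0 ≤ Y) {x : ℝ} (hx : Y * (1 + η) ≤ x)
    (pr : ℕ → Prop) [DecidablePred pr] :
    ∑ n ∈ (Ioc 0 ⌊x⌋₊).filter pr, (windowSeq Y η).a n =
      #{J ∈ idealWindow Y η | pr (Ideal.absNorm J)} := by
  have H : ∀ J ∈ {J ∈ idealWindow Y η | pr (Ideal.absNorm J)},
      Ideal.absNorm J ∈ (Ioc 0 ⌊x⌋₊).filter pr := by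
    intro J hJ
    rw [mem_filter] at hJ
    obtain ⟨hJw, hpr⟩ := hJ
    rw [mem_filter, mem_Ioc]
    exact ⟨⟨absNorm_pos_of_mem_idealWindow hY hJw,
      Nat.le_floor ((mem_idealWindow_iff.mp hJw).2.trans hx)⟩, hpr⟩
  rw [Finset.card_eq_sum_card_fiberwise H, Nat.cast_sum]
  refine Finset.sum_congr rfl fun n hn => ?_
  have hset : {J ∈ {J ∈ idealWindow Y η | pr (Ideal.absNorm J)} | Ideal.absNorm J = n} =
      {J ∈ idealWindow Y η | Ideal.absNorm J = n} := by
    rw [filter_filter]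
    refine filter_congr fun J _ => ⟨fun h => h.2, fun h => ⟨?_, h⟩⟩
    rw [h]
    exact (mem_filter.mp hn).2
  rw [hset]
  rfl

/-- `S(𝒜, P; x) = #{J' : (N(J'), P) = 1}` for the window sequence. [folklore] -/
theorem windowSeq_sifted {Y η : ℝ} (hY : 0 ≤ Y) {x : ℝ} (hx : Y * (1 + η) ≤ x) (P : ℕ) :
    (windowSeq Y η).sifted x P = #{J ∈ idealWindow Y η | (Ideal.absNorm J).Coprime P} :=
  windowSeq_sum_filter_eq_card hY hx _

/-- `A_d(x) = W(Y, η, d)` for the window sequence. [folklore] -/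
theorem windowSeq_congrSum {Y η : ℝ} (hY : 0 ≤ Y) {x : ℝ} (hx : Y * (1 + η) ≤ x) (d : ℕ) :
    (windowSeq Y η).congrSum d x = windowDvdCount Y η d := by
  rw [SieveSequence.congrSum, windowDvdCount]
  exact windowSeq_sum_filter_eq_card hY hx _

/-- `R_d(x) = W(Y, η, d) − γ₀ηY g(d)` for the window sequence. [folklore] -/
theorem windowSeq_remainder {Y η : ℝ} (hY : 0 ≤ Y) {x : ℝ} (hx : Y * (1 + η) ≤ x) (d : ℕ) :
    (windowSeq Y η).remainder d x = windowDvdCount Y η d - gamma₀ * η * Y * normDensity d := by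
  rw [SieveSequence.remainder, windowSeq_congrSum hY hx]
  change _ - normDensity d * (gamma₀ * η * Y) = _
  ring

/-- `V(P(z)) = ∏_{p < z} (1 − g(p))` for the window sequence. [folklore] -/
theorem windowSeq_densityProduct (Y η z : ℝ) :
    (windowSeq Y η).densityProduct (primesProdBelow z) =
      ∏ p ∈ Nat.primesBelow ⌈z⌉₊, (1 - normDensityAt p) := by
  rw [SieveSequence.densityProduct, primeFactors_primesProdBelow]
  exact prod_congr rfl fun p hp => by
    change 1 - normDensity p = _
    rw [normDensity_apply_prime (Nat.prime_of_mem_primesBelow hp)]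

/-! ### The remainder sum `∑_{d ∣ P(z), d ≤ D} |R_d|` -/

/-- `∑_{d ∣ P(z)} 8^{ω(d)}/d = ∏_{p<z} (1 + 8/p) ≤ e^{32} (log z)^8` for `z ≥ 2`. [folklore] -/
theorem sum_divisors_eight_pow_div_le {z : ℝ} (hz : 2 ≤ z) :
    ∑ d ∈ (primesProdBelow z).divisors, (8 : ℝ) ^ #d.primeFactors / d ≤
      Real.exp 32 * Real.log z ^ 8 := by
  have hlogz : 0 < Real.log z := Real.log_pos (by linarith)
  set f : ArithmeticFunction ℝ := ArithmeticFunction.prodPrimeFactors fun p => (8 : ℝ) / p with hf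
  have hfmult : f.IsMultiplicative := ArithmeticFunction.IsMultiplicative.prodPrimeFactors _
  have hsq := squarefree_primesProdBelow z
  have hfd : ∀ d ∈ (primesProdBelow z).divisors, (8 : ℝ) ^ #d.primeFactors / d = f d := by
    intro d hd
    have hd0 : d ≠ 0 := Nat.ne_of_gt (Nat.pos_of_mem_divisors hd)
    have hdsq : Squarefree d := Squarefree.squarefree_of_dvd (Nat.dvd_of_mem_divisors hd) hsq
    rw [hf, ArithmeticFunction.prodPrimeFactors_apply hd0, prod_div_distrib, prod_const]
    congr 1
    rw [← Nat.cast_prod, Nat.prod_primeFactors_of_squarefree hdsq]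
  rw [sum_congr rfl hfd, ← hfmult.prodPrimeFactors_one_add_of_squarefree hsq,
    primeFactors_primesProdBelow]
  have hfp : ∀ p ∈ Nat.primesBelow ⌈z⌉₊, f p = 8 / p := fun p hp => by
    rw [hf, ArithmeticFunction.prodPrimeFactors_apply (Nat.prime_of_mem_primesBelow hp).ne_zero,
      (Nat.prime_of_mem_primesBelow hp).primeFactors, prod_singleton]
  calc ∏ p ∈ Nat.primesBelow ⌈z⌉₊, (1 + f p)
      ≤ ∏ p ∈ Nat.primesBelow ⌈z⌉₊, Real.exp (8 * (1 / (p : ℝ))) := by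
        refine prod_le_prod (fun p hp => ?_) fun p hp => ?_
        · rw [hfp p hp]; positivity
        · rw [hfp p hp]
          have h := Real.add_one_le_exp (8 / (p : ℝ))
          rw [show (8 : ℝ) * (1 / p) = 8 / p by ring]
          linarith
    _ = Real.exp (8 * ∑ p ∈ Nat.primesBelow ⌈z⌉₊, (1 : ℝ) / p) := by rw [mul_sum, Real.exp_sum]
    _ ≤ Real.exp (8 * (Real.log (Real.log z) + 4)) := by gcongr; exact sum_primesBelow_one_div_le hz
    _ = Real.exp 32 * Real.log z ^ 8 := by
        rw [show 8 * (Real.log (Real.log z) + 4) = 32 + (8 : ℕ) * Real.log (Real.log z) by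
          push_cast; ring, Real.exp_add, Real.exp_nat_mul, Real.exp_log hlogz]

/-- **The remainder sum of the window sequence**: with the Type I bound
`|W(Y, η, d) − γ₀ηY g(d)| ≤ C_W 8^{ω(d)} (2Y/d + 1)^{2/3}` one has, for `z ≥ 2`, `D ≥ 1`,
`∑_{d ∣ P(z), d ≤ D} |R_d| ≤ C_W ((2Y)^{2/3} D^{1/3} + D) e^{32} (log z)^8`
(`(2Y/d + 1)^{2/3} ≤ ((2Y)^{2/3} D^{1/3} + D)/d` for `d ≤ D`). [folklore] -/
theorem sum_abs_remainder_windowSeq_le {C_W : ℝ}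
    (hCW : ∀ d : ℕ, Squarefree d → ∀ Y η : ℝ, 0 ≤ Y → 0 ≤ η → η ≤ 1 →
      |(windowDvdCount Y η d : ℝ) - gamma₀ * η * Y * normDensity d| ≤
        C_W * 8 ^ #d.primeFactors * (2 * Y / d + 1) ^ (2 / 3 : ℝ))
    {Y η z D x : ℝ} (hY : 0 ≤ Y) (hη0 : 0 ≤ η) (hη1 : η ≤ 1) (hz : 2 ≤ z) (hD : 1 ≤ D)
    (hx : Y * (1 + η) ≤ x) (hC0 : 0 ≤ C_W) :
    ∑ d ∈ (primesProdBelow z).divisors.filter (fun d : ℕ => (d : ℝ) ≤ D),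
        |(windowSeq Y η).remainder d x| ≤
      C_W * ((2 * Y) ^ (2 / 3 : ℝ) * D ^ (1 / 3 : ℝ) + D) * (Real.exp 32 * Real.log z ^ 8) := by
  set M : ℝ := (2 * Y) ^ (2 / 3 : ℝ) * D ^ (1 / 3 : ℝ) + D with hM
  have hD0 : 0 < D := by linarith
  have hM0 : 0 ≤ M := by positivity
  have hpt : ∀ d ∈ (primesProdBelow z).divisors.filter (fun d : ℕ => (d : ℝ) ≤ D),
      |(windowSeq Y η).remainder d x| ≤ C_W * M * ((8 : ℝ) ^ #d.primeFactors / d) := by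
    intro d hd
    rw [mem_filter] at hd
    obtain ⟨hd, hdD⟩ := hd
    have hd0 : d ≠ 0 := Nat.ne_of_gt (Nat.pos_of_mem_divisors hd)
    have hdsq : Squarefree d :=
      Squarefree.squarefree_of_dvd (Nat.dvd_of_mem_divisors hd) (squarefree_primesProdBelow z)
    have hδ : (0 : ℝ) < d := by exact_mod_cast Nat.pos_of_ne_zero hd0
    rw [windowSeq_remainder hY hx]
    refine (hCW d hdsq Y η hY hη0 hη1).trans ?_
    have hkey : (2 * Y / d + 1) ^ (2 / 3 : ℝ) ≤ M / d := by
      have h1 : 2 * Y / d + 1 ≤ (2 * Y + D) / d := by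
        rw [add_div]
        gcongr
        rwa [le_div_iff₀ hδ, one_mul]
      have h2 : ((2 * Y + D) / d) ^ (2 / 3 : ℝ) =
          (2 * Y + D) ^ (2 / 3 : ℝ) / (d : ℝ) ^ (2 / 3 : ℝ) :=
        Real.div_rpow (by positivity) hδ.le _
      have h3 : (2 * Y + D) ^ (2 / 3 : ℝ) ≤ (2 * Y) ^ (2 / 3 : ℝ) + D ^ (2 / 3 : ℝ) :=
        Real.rpow_add_le_add_rpow (by positivity) hD0.le (by norm_num) (by norm_num)
      have h4 : ((d : ℝ) ^ (2 / 3 : ℝ))⁻¹ ≤ D ^ (1 / 3 : ℝ) / d := by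
        rw [le_div_iff₀ hδ]
        have e : ((d : ℝ) ^ (2 / 3 : ℝ))⁻¹ * d = (d : ℝ) ^ (1 / 3 : ℝ) := by
          have h13 : (d : ℝ) ^ (1 / 3 : ℝ) = (d : ℝ) ^ (1 : ℝ) / (d : ℝ) ^ (2 / 3 : ℝ) := by
            rw [← Real.rpow_sub hδ]; norm_num
          rw [h13, Real.rpow_one]
          field_simp
        rw [e]
        exact Real.rpow_le_rpow hδ.le hdD (by norm_num)
      calc (2 * Y / d + 1) ^ (2 / 3 : ℝ) ≤ ((2 * Y + D) / d) ^ (2 / 3 : ℝ) :=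
            Real.rpow_le_rpow (by positivity) h1 (by norm_num)
        _ = (2 * Y + D) ^ (2 / 3 : ℝ) * ((d : ℝ) ^ (2 / 3 : ℝ))⁻¹ := by rw [h2, div_eq_mul_inv]
        _ ≤ ((2 * Y) ^ (2 / 3 : ℝ) + D ^ (2 / 3 : ℝ)) * (D ^ (1 / 3 : ℝ) / d) :=
            mul_le_mul h3 h4 (by positivity) (by positivity)
        _ = M / d := by
            have hD1 : D ^ (2 / 3 : ℝ) * D ^ (1 / 3 : ℝ) = D := by
              rw [← Real.rpow_add hD0]; norm_num
            rw [hM, add_mul, ← mul_div_assoc, ← mul_div_assoc, hD1, ← add_div]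
    calc C_W * 8 ^ #d.primeFactors * (2 * Y / d + 1) ^ (2 / 3 : ℝ)
        ≤ C_W * 8 ^ #d.primeFactors * (M / d) := by gcongr
      _ = C_W * M * ((8 : ℝ) ^ #d.primeFactors / d) := by ring
  calc ∑ d ∈ (primesProdBelow z).divisors.filter (fun d : ℕ => (d : ℝ) ≤ D),
        |(windowSeq Y η).remainder d x|
      ≤ ∑ d ∈ (primesProdBelow z).divisors.filter (fun d : ℕ => (d : ℝ) ≤ D),
          C_W * M * ((8 : ℝ) ^ #d.primeFactors / d) := sum_le_sum hpt
    _ = C_W * M * ∑ d ∈ (primesProdBelow z).divisors.filter (fun d : ℕ => (d : ℝ) ≤ D),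
          (8 : ℝ) ^ #d.primeFactors / d := by rw [mul_sum]
    _ ≤ C_W * M * ∑ d ∈ (primesProdBelow z).divisors, (8 : ℝ) ^ #d.primeFactors / d :=
        mul_le_mul_of_nonneg_left
          (sum_le_sum_of_subset_of_nonneg (filter_subset _ _) fun d _ _ => by positivity)
          (by positivity)
    _ ≤ C_W * M * (Real.exp 32 * Real.log z ^ 8) := by
        gcongr; exact sum_divisors_eight_pow_div_le hz

/-! ### From `S_K(ℬ^(K)_Q, z)` to the sifted window sequence -/

/-- **`S_K(ℬ^(K)_Q, z) ≤ S(𝒜, P(z₂); x)`** for the window sequence `𝒜` of `Y = 3X³/N(Q)` and any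
`z₂` with `z₂³ ≤ z`: a member `J = Q·J'` of `ℬ^(K)_Q` all of whose prime factors have norm `≥ z` has
`J'` in the window `(Y, Y(1+η)]` with `N(J')` free of rational primes `q < z₂` (a prime of `𝓞_K`
above `q` has norm `≤ q³ < z`). This is the (inequality half of the) passage (6.4), p. 35.
[cite: HeathBrownActa2001, §6 (6.4)] -/
theorem siftedB_le_windowSeq_sifted {X η z z₂ : ℝ} (hX : 0 ≤ X) (hzz : z₂ ^ 3 ≤ z) {Q : Ideal (𝓞 K)} (hQ : Q ≠ ⊥) :
    (siftedB X η Q z : ℝ) ≤ (windowSeq (3 * X ^ 3 / Ideal.absNorm Q) η).sifted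
      (3 * X ^ 3 / Ideal.absNorm Q * (1 + η)) (primesProdBelow z₂) := by
  classical
  set Y := 3 * X ^ 3 / Ideal.absNorm Q with hYdef
  have hNQ0' : Ideal.absNorm Q ≠ 0 := fun h => hQ (Ideal.absNorm_eq_zero_iff.mp h)
  have hNQ : (0 : ℝ) < Ideal.absNorm Q := by positivity
  have hY : 0 ≤ Y := by positivity
  rw [windowSeq_sifted hY le_rfl, siftedB]
  have hsub : {J ∈ BIdeals X η Q | IsRough z J} ⊆
      ({J' ∈ idealWindow Y η | (Ideal.absNorm J').Coprime (primesProdBelow z₂)}).image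
        (fun J' => Q * J') := by
    intro J hJ
    rw [mem_filter, mem_BIdeals_iff, mem_normWindow_iff] at hJ
    obtain ⟨⟨⟨h1, h2⟩, ⟨J', rfl⟩⟩, hrough⟩ := hJ
    rw [map_mul, Nat.cast_mul] at h1 h2
    have hJ'0 : J' ≠ ⊥ := by
      rintro rfl
      rw [Ideal.absNorm_bot, Nat.cast_zero, mul_zero] at h1
      nlinarith [pow_nonneg hX 3]
    refine mem_image.mpr ⟨J', mem_filter.mpr ⟨mem_idealWindow_iff.mpr ⟨?_, ?_⟩, ?_⟩, rfl⟩
    · rw [hYdef, div_lt_iff₀ hNQ]; linarith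
    · rw [hYdef, div_mul_eq_mul_div, le_div_iff₀ hNQ]; linarith
    · rw [coprime_primesProdBelow_iff]
      intro q hq hqJ'
      rw [Nat.mem_primesBelow] at hq
      obtain ⟨hqz, hqp⟩ := hq
      obtain ⟨P, hP, hPJ'⟩ := (dvd_absNorm_iff_exists_mem_primesAbove hqp hJ'0).mp hqJ'
      have hPJ : P ∣ Q * J' := Dvd.dvd.mul_left hPJ' Q
      have hrz : z ≤ (Ideal.absNorm P : ℝ) := hrough (isPrime_of_mem_primesAbove hP).1 hPJ
      obtain ⟨f, hf, hf3, hN⟩ := exists_absNorm_eq_pow_of_mem_primesAbove hqp hP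
      have hq0 : (0 : ℝ) ≤ q := Nat.cast_nonneg q
      have hq1 : (1 : ℝ) ≤ q := by exact_mod_cast hqp.one_lt.le
      have hlt : (Ideal.absNorm P : ℝ) < z := by
        calc (Ideal.absNorm P : ℝ) = (q : ℝ) ^ f := by rw [hN]; push_cast; ring
          _ ≤ (q : ℝ) ^ 3 := pow_le_pow_right₀ hq1 hf3
          _ < z₂ ^ 3 := pow_lt_pow_left₀ (Nat.lt_ceil.mp hqz) hq0 three_ne_zero
          _ ≤ z := hzz
      linarith
  calc (#{J ∈ BIdeals X η Q | IsRough z J} : ℝ)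
      ≤ #(({J' ∈ idealWindow Y η | (Ideal.absNorm J').Coprime (primesProdBelow z₂)}).image
          (fun J' => Q * J')) := by exact_mod_cast card_le_card hsub
    _ ≤ #{J' ∈ idealWindow Y η | (Ideal.absNorm J').Coprime (primesProdBelow z₂)} := by
        exact_mod_cast card_image_le

/-! ### The parameters `τ = (log log X)^{−ϖ}`: what "`X` sufficiently large" provides -/

/-- Eventually in `X` (for `τ = (log log X)^{−ϖ}`, `0 < ϖ ≤ 1`): `X ≥ 16`, `0 < τ ≤ 1/8`,
`τ log X ≥ 20` (so `X^τ ≥ e^{20} ≥ 2^{28}`) and `C₀ (log X)^8 ≤ X^{1/4}`. [folklore] -/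
theorem eventually_params_B (C₀ : ℝ) {ϖ : ℝ} (hϖ0 : 0 < ϖ) (hϖ1 : ϖ ≤ 1) :
    ∀ᶠ X : ℝ in atTop, 16 ≤ X ∧ 0 < hbTau ϖ X ∧ hbTau ϖ X ≤ 1 / 8 ∧
      20 ≤ hbTau ϖ X * Real.log X ∧ C₀ * Real.log X ^ 8 ≤ X ^ (1 / 4 : ℝ) := by
  have h1 := eventually_upperBound_params hϖ0 hϖ1 one_pos 0
  have hlo := Real.isLittleO_log_id_atTop.def (by norm_num : (0 : ℝ) < 1 / 20)
  have hlo2 := (isLittleO_log_rpow_rpow_atTop (8 : ℝ) (by norm_num : (0 : ℝ) < 1 / 4)).def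
    (by positivity : (0 : ℝ) < 1 / (|C₀| + 1))
  filter_upwards [h1, Real.tendsto_log_atTop.eventually hlo,
    Real.tendsto_log_atTop.eventually (eventually_ge_atTop (Real.exp 1)), hlo2,
    eventually_ge_atTop (1 : ℝ)] with X hX hML hL1 hX8 hX1
  obtain ⟨hX16, hτ0, hτ8, -, -⟩ := hX
  have hL0 : 0 < Real.log X := lt_of_lt_of_le (Real.exp_pos 1) hL1
  have hM1 : 1 ≤ Real.log (Real.log X) := by
    rw [← Real.log_exp 1]; exact Real.log_le_log (Real.exp_pos 1) hL1
  have hM0 : 0 < Real.log (Real.log X) := by linarith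
  refine ⟨hX16, hτ0, hτ8, ?_, ?_⟩
  · have hML' : Real.log (Real.log X) ≤ 1 / 20 * Real.log X := by
      have h := hML
      simp only [Real.norm_eq_abs, id, abs_of_pos hM0, abs_of_pos hL0] at h
      exact h
    have hτ : hbTau ϖ X = Real.log (Real.log X) ^ (-ϖ) := rfl
    have hτM : (Real.log (Real.log X))⁻¹ ≤ hbTau ϖ X := by
      rw [hτ, Real.rpow_neg hM0.le]
      refine inv_anti₀ (Real.rpow_pos_of_pos hM0 _) ?_
      calc Real.log (Real.log X) ^ ϖ ≤ Real.log (Real.log X) ^ (1 : ℝ) :=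
            Real.rpow_le_rpow_of_exponent_le hM1 hϖ1
        _ = Real.log (Real.log X) := Real.rpow_one _
    calc (20 : ℝ) ≤ (Real.log (Real.log X))⁻¹ * Real.log X := by
          rw [le_inv_mul_iff₀ hM0]; linarith
      _ ≤ hbTau ϖ X * Real.log X := by gcongr
  · have h := hX8
    rw [Real.norm_eq_abs, Real.norm_eq_abs, abs_of_nonneg (Real.rpow_nonneg hL0.le _),
      abs_of_nonneg (Real.rpow_nonneg (by linarith) _)] at h
    rw [show (8 : ℝ) = ((8 : ℕ) : ℝ) by norm_num, Real.rpow_natCast] at h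
    have hC : |C₀| * (1 / (|C₀| + 1)) ≤ 1 := by
      rw [mul_one_div, div_le_one (by positivity)]; linarith
    have hX4 : 0 ≤ X ^ (1 / 4 : ℝ) := Real.rpow_nonneg (by linarith) _
    calc C₀ * Real.log X ^ 8 ≤ |C₀| * Real.log X ^ 8 := by gcongr; exact le_abs_self _
      _ ≤ |C₀| * (1 / (|C₀| + 1) * X ^ (1 / 4 : ℝ)) := by gcongr
      _ = |C₀| * (1 / (|C₀| + 1)) * X ^ (1 / 4 : ℝ) := by ring
      _ ≤ 1 * X ^ (1 / 4 : ℝ) := by gcongr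
      _ = X ^ (1 / 4 : ℝ) := one_mul _

/-! ### Lemma 7.1, the `ℬ^(K)`-half: the pieces -/

/-- The number of ideals with norm in `𝒬 ⊆ [0, 2N]` is `≤ I_K(2N) + 1 ≪ N` for `N ≥ 1/2`. [folklore] -/
theorem card_normIn_le_of {C_I : ℝ} (hCI0 : 0 ≤ C_I)
    (hCI : ∀ t : ℝ, 0 ≤ t → |(idealCount K t : ℝ) - gamma₀ * t| ≤ C_I * (t + 1) ^ (2 / 3 : ℝ))
    {N : ℝ} (hN : 1 / 2 ≤ N) {𝒬 : Finset ℕ} (h𝒬 : ∀ q ∈ 𝒬, (q : ℝ) ≤ 2 * N) :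
    (#(normIn 𝒬) : ℝ) ≤ (4 * (gamma₀ + 2 * C_I) + 4) * N := by
  have hρ0 : 0 < gamma₀ := gamma₀_pos
  have h2N : (0 : ℝ) ≤ 2 * N := by linarith
  have hsub : normIn 𝒬 ⊆ {J ∈ idealsLE ⌊2 * N⌋₊ | (Ideal.absNorm J : ℝ) ≤ 2 * N} := by
    intro Q hQ
    have h2 := h𝒬 _ (mem_normIn_iff.mp hQ)
    rw [mem_filter, mem_idealsLE]
    exact ⟨Nat.le_floor h2, h2⟩
  have hpow : (2 * N + 1) ^ (2 / 3 : ℝ) ≤ 2 * N + 1 := by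
    calc (2 * N + 1) ^ (2 / 3 : ℝ) ≤ (2 * N + 1) ^ (1 : ℝ) :=
          Real.rpow_le_rpow_of_exponent_le (by linarith) (by norm_num)
      _ = 2 * N + 1 := Real.rpow_one _
  have hI := (abs_le.mp (hCI (2 * N) h2N)).2
  have e1 : C_I ≤ C_I * (2 * N) := le_mul_of_one_le_right hCI0 (by linarith)
  have e2 : 0 ≤ gamma₀ * N := by positivity
  have e3 : 0 ≤ C_I * N := by positivity
  calc (#(normIn 𝒬) : ℝ) ≤ #{J ∈ idealsLE ⌊2 * N⌋₊ | (Ideal.absNorm J : ℝ) ≤ 2 * N} := by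
        exact_mod_cast card_le_card hsub
    _ = idealCount K (2 * N) + 1 := card_filter_absNorm_le h2N le_rfl
    _ ≤ gamma₀ * (2 * N) + C_I * (2 * N + 1) ^ (2 / 3 : ℝ) + 1 := by linarith
    _ ≤ gamma₀ * (2 * N) + C_I * (2 * N + 1) + 1 := by gcongr
    _ ≤ (4 * (gamma₀ + 2 * C_I) + 4) * N := by linarith

/-- **The sieve bound for one ideal `Q`** (the heart of Lemma 7.1 for `ℬ^(K)`): with
`z₁ ≥ e^{20}`, `z₁ ≤ z`, `z₂ = z₁^{1/28}`, `D = z₁`, `Y = 3X³/N(Q)`: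
`S_K(ℬ^(K)_Q, z) ≤ S(𝒜_Y, P(z₂)) ≤ (1 + 2K₃^{10}) γ₀ηY V(z₂) + ∑_{d ≤ z₁} |R_d|`, the main term
being `≤ 84(1 + 2K₃^{10})γ₀K_V · ηX³/(N(Q) log z₁)` and the remainder
`≤ C_W e^{32} (log z₁)^8 (6X² z₁^{1/3}/N^{2/3} + z₁)` for `N < N(Q)`.
[cite: HeathBrownActa2001, Lemma 7.1 (proof, pp. 40–41)] -/
theorem siftedB_le_main_add_err {C_W Kv K₃ : ℝ} (hCW0 : 0 ≤ C_W)
    (hCW : ∀ d : ℕ, Squarefree d → ∀ Y η : ℝ, 0 ≤ Y → 0 ≤ η → η ≤ 1 →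
      |(windowDvdCount Y η d : ℝ) - gamma₀ * η * Y * normDensity d| ≤
        C_W * 8 ^ #d.primeFactors * (2 * Y / d + 1) ^ (2 / 3 : ℝ))
    (hKv : ∀ z : ℝ, 2 ≤ z → ∏ p ∈ Nat.primesBelow ⌈z⌉₊, (1 - normDensityAt p) ≤ Kv / Real.log z)
    (hdim : HasSieveDimension normDensity 3 K₃)
    {X η z z₁ N : ℝ} (hX : 1 < X) (hη0 : 0 < η) (hη1 : η ≤ 1) (hN : 0 < N)
    (hz₁20 : Real.exp 20 ≤ z₁) (hz₁z : z₁ ≤ z)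
    {Q : Ideal (𝓞 K)} (hQ0 : Q ≠ ⊥) (hNq : N < Ideal.absNorm Q) :
    (siftedB X η Q z : ℝ) ≤
      (1 + 2 * K₃ ^ 10) * gamma₀ * Kv * 84 * (η * X ^ 3 / Real.log z₁) *
          ((Ideal.absNorm Q : ℕ) : ℝ)⁻¹ +
        C_W * Real.exp 32 * Real.log z₁ ^ 8 *
          (6 * X ^ 2 * z₁ ^ (1 / 3 : ℝ) / N ^ (2 / 3 : ℝ) + z₁) := by
  have hX0 : 0 < X := by linarith
  have hρ0 : 0 < gamma₀ := gamma₀_pos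
  -- `z₁`
  have hz₁1 : 1 < z₁ := lt_of_lt_of_le (Real.one_lt_exp_iff.mpr (by norm_num)) hz₁20
  have hz₁0 : 0 < z₁ := by linarith
  have hL₁ : 0 < Real.log z₁ := Real.log_pos hz₁1
  have hL₁20 : 20 ≤ Real.log z₁ := by
    rw [← Real.log_exp 20]; exact Real.log_le_log (Real.exp_pos _) hz₁20
  -- `z₂ = z₁^{1/28} ≥ 2`, `z₂³ ≤ z`, `D = z₁`
  set z₂ := z₁ ^ (1 / 28 : ℝ) with hz₂
  have hz₂pos : 0 < z₂ := Real.rpow_pos_of_pos hz₁0 _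
  have hlogz₂ : Real.log z₂ = Real.log z₁ / 28 := by
    rw [hz₂, Real.log_rpow hz₁0]; ring
  have hlogz₂0 : 0 < Real.log z₂ := by rw [hlogz₂]; positivity
  have hz₂2 : 2 ≤ z₂ := by
    have h : Real.log 2 ≤ Real.log z₂ := by
      rw [hlogz₂]; have := Real.log_two_lt_d9; linarith
    exact (Real.log_le_log_iff two_pos hz₂pos).mp h
  have hz₂3 : z₂ ^ 3 ≤ z := by
    calc z₂ ^ 3 = z₁ ^ (3 / 28 : ℝ) := by
          rw [hz₂, ← Real.rpow_natCast, ← Real.rpow_mul hz₁0.le]; norm_num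
      _ ≤ z₁ ^ (1 : ℝ) := Real.rpow_le_rpow_of_exponent_le hz₁1.le (by norm_num)
      _ = z₁ := Real.rpow_one z₁
      _ ≤ z := hz₁z
  have hD1 : 1 ≤ z₁ := hz₁1.le
  have hzD : (9 * 3 + 1) * Real.log z₂ ≤ Real.log z₁ := by rw [hlogz₂]; linarith
  have hexp1 : Real.exp ((9 * 3 + 1) - Real.log z₁ / Real.log z₂) = 1 := by
    rw [hlogz₂, show ((9 : ℝ) * 3 + 1) - Real.log z₁ / (Real.log z₁ / 28) = 0 by
      field_simp; ring]
    exact Real.exp_zero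
  -- the window sequence of `Y = 3X³/q`
  set q : ℝ := ((Ideal.absNorm Q : ℕ) : ℝ) with hqdef
  have hq0 : 0 < q := hN.trans hNq
  set Y : ℝ := 3 * X ^ 3 / q with hYdef
  have hY0 : 0 ≤ Y := by positivity
  set A := windowSeq Y η with hA
  have h1 : (siftedB X η Q z : ℝ) ≤ A.sifted (Y * (1 + η)) (primesProdBelow z₂) :=
    siftedB_le_windowSeq_sifted hX0.le hz₂3 hQ0
  have hsize : 0 ≤ A.size (Y * (1 + η)) := by
    change 0 ≤ gamma₀ * η * Y; positivity
  have h2 := SieveSequence.sifted_le_of_dvd_primesProdBelow (A := A) hdim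
    (by norm_num : (0 : ℝ) < 3) (x := Y * (1 + η)) hz₂2 hz₁1 hzD hsize
    (dvd_refl (primesProdBelow z₂))
  rw [hexp1, mul_one] at h2
  -- main term
  have hV : A.densityProduct (primesProdBelow z₂) ≤ Kv / Real.log z₂ := by
    rw [hA, windowSeq_densityProduct]; exact hKv z₂ hz₂2
  have hmain : (1 + 2 * K₃ ^ 10) * (A.size (Y * (1 + η)) * A.densityProduct (primesProdBelow z₂)) ≤
      (1 + 2 * K₃ ^ 10) * gamma₀ * Kv * 84 * (η * X ^ 3 / Real.log z₁) * q⁻¹ := by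
    change (1 + 2 * K₃ ^ 10) * (gamma₀ * η * Y * A.densityProduct (primesProdBelow z₂)) ≤ _
    have hK : 0 ≤ 1 + 2 * K₃ ^ 10 := by
      have := hdim.one_le; positivity
    calc (1 + 2 * K₃ ^ 10) * (gamma₀ * η * Y * A.densityProduct (primesProdBelow z₂))
        ≤ (1 + 2 * K₃ ^ 10) * (gamma₀ * η * Y * (Kv / Real.log z₂)) := by gcongr
      _ = (1 + 2 * K₃ ^ 10) * gamma₀ * Kv * 84 * (η * X ^ 3 / Real.log z₁) * q⁻¹ := by
          rw [hlogz₂, hYdef]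
          field_simp
          ring
  -- remainder term
  have herr : ∑ d ∈ (primesProdBelow z₂).divisors.filter (fun d : ℕ => (d : ℝ) ≤ z₁),
      |A.remainder d (Y * (1 + η))| ≤
        C_W * ((2 * Y) ^ (2 / 3 : ℝ) * z₁ ^ (1 / 3 : ℝ) + z₁) *
          (Real.exp 32 * Real.log z₂ ^ 8) :=
    sum_abs_remainder_windowSeq_le hCW hY0 hη0.le hη1 hz₂2 hD1 le_rfl hCW0
  have hlz : Real.log z₂ ^ 8 ≤ Real.log z₁ ^ 8 := by
    apply pow_le_pow_left₀ hlogz₂0.le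
    rw [hlogz₂]; linarith
  have h2Y : (2 * Y) ^ (2 / 3 : ℝ) ≤ 6 * X ^ 2 / N ^ (2 / 3 : ℝ) := by
    have hle : 2 * Y ≤ 6 * X ^ 3 / N := by
      rw [hYdef, show 2 * (3 * X ^ 3 / q) = 6 * X ^ 3 / q by ring]
      exact div_le_div_of_nonneg_left (by positivity) hN hNq.le
    have hX3 : (X ^ 3) ^ (2 / 3 : ℝ) = X ^ 2 := by
      rw [show X ^ 3 = X ^ (3 : ℝ) by norm_cast, ← Real.rpow_mul hX0.le]
      norm_num
    have h6 : (6 : ℝ) ^ (2 / 3 : ℝ) ≤ 6 := by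
      calc (6 : ℝ) ^ (2 / 3 : ℝ) ≤ (6 : ℝ) ^ (1 : ℝ) :=
            Real.rpow_le_rpow_of_exponent_le (by norm_num) (by norm_num)
        _ = 6 := Real.rpow_one 6
    calc (2 * Y) ^ (2 / 3 : ℝ) ≤ (6 * X ^ 3 / N) ^ (2 / 3 : ℝ) :=
          Real.rpow_le_rpow (by positivity) hle (by norm_num)
      _ = (6 : ℝ) ^ (2 / 3 : ℝ) * (X ^ 3) ^ (2 / 3 : ℝ) / N ^ (2 / 3 : ℝ) := by
          rw [Real.div_rpow (by positivity) hN.le, Real.mul_rpow (by norm_num) (by positivity)]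
      _ = (6 : ℝ) ^ (2 / 3 : ℝ) * X ^ 2 / N ^ (2 / 3 : ℝ) := by rw [hX3]
      _ ≤ 6 * X ^ 2 / N ^ (2 / 3 : ℝ) := by gcongr
  have herr2 : C_W * ((2 * Y) ^ (2 / 3 : ℝ) * z₁ ^ (1 / 3 : ℝ) + z₁) *
        (Real.exp 32 * Real.log z₂ ^ 8) ≤
      C_W * Real.exp 32 * Real.log z₁ ^ 8 *
        (6 * X ^ 2 * z₁ ^ (1 / 3 : ℝ) / N ^ (2 / 3 : ℝ) + z₁) := by
    calc C_W * ((2 * Y) ^ (2 / 3 : ℝ) * z₁ ^ (1 / 3 : ℝ) + z₁) * (Real.exp 32 * Real.log z₂ ^ 8)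
        ≤ C_W * (6 * X ^ 2 / N ^ (2 / 3 : ℝ) * z₁ ^ (1 / 3 : ℝ) + z₁) *
            (Real.exp 32 * Real.log z₁ ^ 8) := by gcongr
      _ = C_W * Real.exp 32 * Real.log z₁ ^ 8 *
            (6 * X ^ 2 * z₁ ^ (1 / 3 : ℝ) / N ^ (2 / 3 : ℝ) + z₁) := by ring
  calc (siftedB X η Q z : ℝ) ≤ A.sifted (Y * (1 + η)) (primesProdBelow z₂) := h1
    _ ≤ _ := h2
    _ ≤ _ := add_le_add hmain (herr.trans herr2)

/-- **The total remainder is `≤ X^{3−τ/5}`**: with `#normIn 𝒬 ≤ C₂N`, `N ≥ 1/2`,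
`z₁ ≤ X^{2−τ}/N` (so `Nz₁ ≤ X²`, `log z₁ ≤ 3 log X`) the summed remainder is
`≤ 7·3⁸e^{32}C₂C_W (log X)^8 X^{8/3} ≤ X^{1/4} X^{8/3} ≤ X^{3−τ/5}` (`τ ≤ 1/8`). [folklore] -/
theorem total_err_le {C₂ C_W : ℝ} (hC₂0 : 0 < C₂) (hCW0 : 0 ≤ C_W) {X N z₁ τ : ℝ} (hX16 : 16 ≤ X)
    (hτ0 : 0 < τ) (hτ8 : τ ≤ 1 / 8) (hN : 1 / 2 ≤ N) (hz₁1 : 1 < z₁)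
    (hz₁le : z₁ ≤ X ^ (2 - τ) / N)
    (hlogX : 7 * 3 ^ 8 * Real.exp 32 * C₂ * C_W * Real.log X ^ 8 ≤ X ^ (1 / 4 : ℝ))
    {m : ℝ} (hm : m ≤ C₂ * N) :
    m * (C_W * Real.exp 32 * Real.log z₁ ^ 8 *
        (6 * X ^ 2 * z₁ ^ (1 / 3 : ℝ) / N ^ (2 / 3 : ℝ) + z₁)) ≤ X ^ (3 - τ / 5) := by
  have hX1 : 1 < X := by linarith
  have hX0 : 0 < X := by linarith
  have hN0 : 0 < N := by linarith
  have hL : 0 < Real.log X := Real.log_pos hX1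
  have hz₁0 : 0 < z₁ := by linarith
  have hL₁ : 0 < Real.log z₁ := Real.log_pos hz₁1
  have hX2τ : X ^ (2 - τ) ≤ X ^ 2 := by
    rw [show X ^ 2 = X ^ (2 : ℝ) by norm_cast]
    exact Real.rpow_le_rpow_of_exponent_le hX1.le (by linarith)
  have hz₁X : z₁ ≤ X ^ 2 / N := hz₁le.trans (div_le_div_of_nonneg_right hX2τ hN0.le)
  have hL₁3 : Real.log z₁ ≤ 3 * Real.log X := by
    have h2X : z₁ ≤ X ^ 3 := by
      calc z₁ ≤ X ^ 2 / N := hz₁X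
        _ ≤ X ^ 2 / (1 / 2) := div_le_div_of_nonneg_left (by positivity) (by norm_num) hN
        _ = 2 * X ^ 2 := by ring
        _ ≤ X ^ 3 := by nlinarith
    calc Real.log z₁ ≤ Real.log (X ^ 3) := Real.log_le_log hz₁0 h2X
      _ = 3 * Real.log X := by rw [Real.log_pow]; push_cast; ring
  have hNz₁ : N * z₁ ≤ X ^ 2 := by
    calc N * z₁ ≤ N * (X ^ (2 - τ) / N) := by gcongr
      _ = X ^ (2 - τ) := mul_div_cancel₀ _ hN0.ne'
      _ ≤ X ^ 2 := hX2τ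
  have h13 : N / N ^ (2 / 3 : ℝ) = N ^ (1 / 3 : ℝ) := by
    rw [show (1 : ℝ) / 3 = 1 - 2 / 3 by norm_num, Real.rpow_sub hN0, Real.rpow_one]
  have hNz3 : N * (6 * X ^ 2 * z₁ ^ (1 / 3 : ℝ) / N ^ (2 / 3 : ℝ)) =
      6 * X ^ 2 * (N * z₁) ^ (1 / 3 : ℝ) := by
    rw [Real.mul_rpow hN0.le hz₁0.le]
    calc N * (6 * X ^ 2 * z₁ ^ (1 / 3 : ℝ) / N ^ (2 / 3 : ℝ))
        = 6 * X ^ 2 * z₁ ^ (1 / 3 : ℝ) * (N / N ^ (2 / 3 : ℝ)) := by ring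
      _ = 6 * X ^ 2 * (N ^ (1 / 3 : ℝ) * z₁ ^ (1 / 3 : ℝ)) := by rw [h13]; ring
  have hNz13 : (N * z₁) ^ (1 / 3 : ℝ) ≤ X ^ (2 / 3 : ℝ) := by
    calc (N * z₁) ^ (1 / 3 : ℝ) ≤ (X ^ 2) ^ (1 / 3 : ℝ) :=
          Real.rpow_le_rpow (by positivity) hNz₁ (by norm_num)
      _ = X ^ (2 / 3 : ℝ) := by
          rw [show X ^ 2 = X ^ (2 : ℝ) by norm_cast, ← Real.rpow_mul hX0.le]; norm_num
  have hX83 : X ^ 2 * X ^ (2 / 3 : ℝ) = X ^ (8 / 3 : ℝ) := by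
    rw [show X ^ 2 = X ^ (2 : ℝ) by norm_cast, ← Real.rpow_add hX0]; norm_num
  have hX2le : X ^ 2 ≤ X ^ (8 / 3 : ℝ) := by
    rw [show X ^ 2 = X ^ (2 : ℝ) by norm_cast]
    exact Real.rpow_le_rpow_of_exponent_le hX1.le (by norm_num)
  have hT : N * (6 * X ^ 2 * z₁ ^ (1 / 3 : ℝ) / N ^ (2 / 3 : ℝ) + z₁) ≤ 7 * X ^ (8 / 3 : ℝ) := by
    rw [mul_add, hNz3]
    calc 6 * X ^ 2 * (N * z₁) ^ (1 / 3 : ℝ) + N * z₁ ≤ 6 * X ^ 2 * X ^ (2 / 3 : ℝ) + X ^ 2 := by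
          gcongr
      _ = 6 * X ^ (8 / 3 : ℝ) + X ^ 2 := by rw [mul_assoc, hX83]
      _ ≤ 6 * X ^ (8 / 3 : ℝ) + X ^ (8 / 3 : ℝ) := by gcongr
      _ = 7 * X ^ (8 / 3 : ℝ) := by ring
  have hinner0 : 0 ≤ 6 * X ^ 2 * z₁ ^ (1 / 3 : ℝ) / N ^ (2 / 3 : ℝ) + z₁ := by positivity
  have hcoef0 : 0 ≤ C₂ * C_W * Real.exp 32 * 3 ^ 8 * Real.log X ^ 8 :=
    mul_nonneg (mul_nonneg (mul_nonneg (mul_nonneg hC₂0.le hCW0) (Real.exp_pos _).le)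
      (by norm_num)) (pow_nonneg hL.le 8)
  have hlogpow : Real.log z₁ ^ 8 ≤ (3 * Real.log X) ^ 8 := pow_le_pow_left₀ hL₁.le hL₁3 8
  have hS0 : 0 ≤ C_W * Real.exp 32 * Real.log z₁ ^ 8 *
      (6 * X ^ 2 * z₁ ^ (1 / 3 : ℝ) / N ^ (2 / 3 : ℝ) + z₁) := by positivity
  have hSS : C_W * Real.exp 32 * Real.log z₁ ^ 8 *
      (6 * X ^ 2 * z₁ ^ (1 / 3 : ℝ) / N ^ (2 / 3 : ℝ) + z₁) ≤
      C_W * Real.exp 32 * (3 * Real.log X) ^ 8 *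
        (6 * X ^ 2 * z₁ ^ (1 / 3 : ℝ) / N ^ (2 / 3 : ℝ) + z₁) := by gcongr
  calc m * (C_W * Real.exp 32 * Real.log z₁ ^ 8 *
        (6 * X ^ 2 * z₁ ^ (1 / 3 : ℝ) / N ^ (2 / 3 : ℝ) + z₁))
      ≤ (C₂ * N) * (C_W * Real.exp 32 * (3 * Real.log X) ^ 8 *
          (6 * X ^ 2 * z₁ ^ (1 / 3 : ℝ) / N ^ (2 / 3 : ℝ) + z₁)) :=
        mul_le_mul hm hSS hS0 (by positivity)
    _ = C₂ * C_W * Real.exp 32 * 3 ^ 8 * Real.log X ^ 8 *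
          (N * (6 * X ^ 2 * z₁ ^ (1 / 3 : ℝ) / N ^ (2 / 3 : ℝ) + z₁)) := by ring
    _ ≤ C₂ * C_W * Real.exp 32 * 3 ^ 8 * Real.log X ^ 8 * (7 * X ^ (8 / 3 : ℝ)) :=
        mul_le_mul_of_nonneg_left hT hcoef0
    _ = 7 * 3 ^ 8 * Real.exp 32 * C₂ * C_W * Real.log X ^ 8 * X ^ (8 / 3 : ℝ) := by ring
    _ ≤ X ^ (1 / 4 : ℝ) * X ^ (8 / 3 : ℝ) := by gcongr
    _ = X ^ (35 / 12 : ℝ) := by rw [← Real.rpow_add hX0]; norm_num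
    _ ≤ X ^ (3 - τ / 5) := Real.rpow_le_rpow_of_exponent_le hX1.le (by linarith)

/-! ### Lemma 7.1, the `ℬ^(K)`-half, proved -/

/-- **Heath-Brown's Lemma 7.1 for `ℬ^(K)`, PROVED** (the second display of Lemma 7.1, p. 39, in the
corrected ideal-weighted form of `HeathBrown2001_lemma_7_1_normWeighted`): for `0 < ϖ ≤ 1` there
are `C, X₀` such that for `X ≥ X₀`, `exp(−(log X)^{1/3}) ≤ η ≤ 1`, `τ = (log log X)^{−ϖ}`,
`z ≥ X^τ`, `0 < N ≤ X^{2−2τ}` and every finite set `𝒬` of square-free `q ∈ (N, 2N]`,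
`∑_{N(Q)∈𝒬} S_K(ℬ^(K)_Q, z) ≤ C (ηX³ / log min(z, X^{2−τ}/N) · ∑_{N(Q)∈𝒬} N(Q)^{-1} + X^{3−τ/5})`.
Proof (pp. 40–41, with the beta-sieve upper bound of the tree in place of Selberg's and the
Weber–Landau count in place of Lemma 3.3): with `z₁ = min(z, X^{2−τ}/N) ≥ X^τ ≥ e^{20}`, `D = z₁`,
`z₂ = z₁^{1/28}`, each `S_K(ℬ^(K)_Q, z)` is at most the sifted sum of the window sequence of
`Y = 3X³/N(Q)` by the primes `< z₂` (`siftedB_le_windowSeq_sifted`, the inequality half of (6.4)),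
which `SieveSequence.sifted_le_of_dvd_primesProdBelow` (dimension `3`,
`hasSieveDimension_normDensity`) bounds by `(1 + 2K₃^{10})γ₀ηY V(z₂) + ∑_{d ≤ D} |R_d|`; here
`V(z₂) ≤ K_V/log z₂ = 28K_V/log z₁` (Mertens for the degree-one primes of `K`, from the prime
ideal theorem proved in the tree) and the remainders are controlled by
`exists_windowDvdCount_sub_le` (Weber–Landau), their total over the `≪ N` ideals `Q` being
`≪ X^{8/3}(log X)^8 ≤ X^{3−τ/5}` (`total_err_le`). [cite: HeathBrownActa2001, Lemma 7.1] -/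
theorem HeathBrown2001_lemma_7_1_B {ϖ : ℝ} (hϖ0 : 0 < ϖ) (hϖ1 : ϖ ≤ 1) :
    ∃ C X₀ : ℝ, ∀ X η : ℝ, X₀ ≤ X → Real.exp (-Real.log X ^ (1 / 3 : ℝ)) ≤ η → η ≤ 1 →
      ∀ (N z : ℝ) (𝒬 : Finset ℕ), X ^ hbTau ϖ X ≤ z → 0 < N → N ≤ X ^ (2 - 2 * hbTau ϖ X) →
        (∀ q ∈ 𝒬, Squarefree q ∧ N < q ∧ (q : ℝ) ≤ 2 * N) →
        (∑ Q ∈ normIn 𝒬, (siftedB X η Q z : ℝ)) ≤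
            C * (η * X ^ 3 / Real.log (min z (X ^ (2 - hbTau ϖ X) / N)) *
                  ∑ Q ∈ normIn 𝒬, ((Ideal.absNorm Q : ℕ) : ℝ)⁻¹ + X ^ (3 - hbTau ϖ X / 5)) := by
  classical
  obtain ⟨C_W, hCW0, hCW⟩ := exists_windowDvdCount_sub_le
  obtain ⟨Kv, hKv0, hKv⟩ := exists_prod_one_sub_normDensityAt_le
  obtain ⟨C_I, hCI0, hCI⟩ := exists_idealCount_sub_le
  obtain ⟨K₃, hK₃⟩ : ∃ K₃ : ℝ, K₃ = Real.exp (3 * (9 / 2 + 6 / Real.log 2) + 3) := ⟨_, rfl⟩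
  have hdim : HasSieveDimension normDensity 3 K₃ := hK₃ ▸ hasSieveDimension_normDensity
  have hρ0 : 0 < gamma₀ := gamma₀_pos
  set C₁ : ℝ := (1 + 2 * K₃ ^ 10) * gamma₀ * Kv * 84 with hC₁
  set C₂ : ℝ := 4 * (gamma₀ + 2 * C_I) + 4 with hC₂
  have hC₂0 : 0 < C₂ := by rw [hC₂]; linarith
  obtain ⟨X₀, hX₀⟩ :=
    Filter.eventually_atTop.mp (eventually_params_B (7 * 3 ^ 8 * Real.exp 32 * C₂ * C_W) hϖ0 hϖ1)
  refine ⟨max C₁ 1, X₀, fun X η hX hηlo hη1 N z 𝒬 hz hN hN2 h𝒬 => ?_⟩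
  obtain ⟨hX16, hτ0, hτ8, hτL, hlogX⟩ := hX₀ X hX
  set τ := hbTau ϖ X with hτdef
  have hX1 : 1 < X := by linarith
  have hX0 : 0 < X := by linarith
  have hη0 : 0 < η := lt_of_lt_of_le (Real.exp_pos _) hηlo
  -- `z₁ = min z (X^{2−τ}/N) ≥ X^τ ≥ e^{20}`
  set z₁ := min z (X ^ (2 - τ) / N) with hz₁
  have hz₁ge : X ^ τ ≤ z₁ := by
    refine le_min hz ?_
    rw [le_div_iff₀ hN]
    calc X ^ τ * N ≤ X ^ τ * X ^ (2 - 2 * τ) := by gcongr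
      _ = X ^ (2 - τ) := by rw [← Real.rpow_add hX0]; ring_nf
  have hz₁20 : Real.exp 20 ≤ z₁ := by
    have hXτ : X ^ τ = Real.exp (τ * Real.log X) := by
      rw [Real.rpow_def_of_pos hX0, mul_comm]
    rw [hXτ] at hz₁ge
    exact (Real.exp_le_exp.mpr hτL).trans hz₁ge
  have hz₁1 : 1 < z₁ := lt_of_lt_of_le (Real.one_lt_exp_iff.mpr (by norm_num)) hz₁20
  have hL₁ : 0 < Real.log z₁ := Real.log_pos hz₁1
  have hRHS0 : 0 ≤ η * X ^ 3 / Real.log z₁ * ∑ Q ∈ normIn 𝒬, ((Ideal.absNorm Q : ℕ) : ℝ)⁻¹ :=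
    mul_nonneg (by positivity) (sum_nonneg fun Q _ => by positivity)
  have hXpow0 : 0 ≤ X ^ (3 - τ / 5) := Real.rpow_nonneg hX0.le _
  -- the case `N < 1/2`: `𝒬 = ∅`
  rcases lt_or_ge N (1 / 2) with hNsmall | hNbig
  · have h𝒬e : 𝒬 = ∅ := by
      rw [Finset.eq_empty_iff_forall_notMem]
      intro q hq
      obtain ⟨-, hNq, hq2⟩ := h𝒬 q hq
      have hq1 : q < 1 := by exact_mod_cast (show (q : ℝ) < 1 by linarith)
      have hq0 : q = 0 := by omega
      rw [hq0, Nat.cast_zero] at hNq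
      linarith
    rw [h𝒬e, normIn_empty, sum_empty, sum_empty, mul_zero, zero_add]
    exact mul_nonneg (zero_le_one.trans (le_max_right _ _)) hXpow0
  -- facts about `Q ∈ normIn 𝒬`
  have hQfacts : ∀ Q ∈ normIn 𝒬, Q ≠ ⊥ ∧ (N : ℝ) < Ideal.absNorm Q := by
    intro Q hQ
    obtain ⟨-, hNq, -⟩ := h𝒬 _ (mem_normIn_iff.mp hQ)
    refine ⟨fun h => ?_, hNq⟩
    rw [h, Ideal.absNorm_bot, Nat.cast_zero] at hNq
    linarith
  have hcard : (#(normIn 𝒬) : ℝ) ≤ C₂ * N :=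
    card_normIn_le_of hCI0 hCI hNbig fun q hq => (h𝒬 q hq).2.2
  -- sum the bounds for single `Q`
  have hQbound : ∀ Q ∈ normIn 𝒬, (siftedB X η Q z : ℝ) ≤
      C₁ * (η * X ^ 3 / Real.log z₁) * ((Ideal.absNorm Q : ℕ) : ℝ)⁻¹ +
        C_W * Real.exp 32 * Real.log z₁ ^ 8 *
          (6 * X ^ 2 * z₁ ^ (1 / 3 : ℝ) / N ^ (2 / 3 : ℝ) + z₁) := fun Q hQ =>
    siftedB_le_main_add_err hCW0 hCW hKv hdim hX1 hη0 hη1 hN hz₁20 (min_le_left _ _)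
      (hQfacts Q hQ).1 (hQfacts Q hQ).2
  have hsum := sum_le_sum hQbound
  rw [sum_add_distrib, sum_const, nsmul_eq_mul, ← mul_sum] at hsum
  have hE := total_err_le hC₂0 hCW0 hX16 hτ0 hτ8 hNbig hz₁1 (min_le_right _ _) hlogX hcard
  -- conclusion
  have hC₁le : C₁ ≤ max C₁ 1 := le_max_left _ _
  have h1le : (1 : ℝ) ≤ max C₁ 1 := le_max_right _ _
  calc ∑ Q ∈ normIn 𝒬, (siftedB X η Q z : ℝ)
      ≤ C₁ * (η * X ^ 3 / Real.log z₁) * ∑ Q ∈ normIn 𝒬, ((Ideal.absNorm Q : ℕ) : ℝ)⁻¹ +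
          #(normIn 𝒬) * (C_W * Real.exp 32 * Real.log z₁ ^ 8 *
            (6 * X ^ 2 * z₁ ^ (1 / 3 : ℝ) / N ^ (2 / 3 : ℝ) + z₁)) := hsum
    _ ≤ max C₁ 1 * (η * X ^ 3 / Real.log z₁ * ∑ Q ∈ normIn 𝒬, ((Ideal.absNorm Q : ℕ) : ℝ)⁻¹) +
          max C₁ 1 * X ^ (3 - τ / 5) := by
        refine add_le_add ?_ (hE.trans (le_mul_of_one_le_left hXpow0 h1le))
        rw [mul_assoc]
        exact mul_le_mul_of_nonneg_right hC₁le hRHS0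
    _ = max C₁ 1 * (η * X ^ 3 / Real.log z₁ * ∑ Q ∈ normIn 𝒬, ((Ideal.absNorm Q : ℕ) : ℝ)⁻¹ +
          X ^ (3 - τ / 5)) := by ring

end Literature.NumberTheory.Sieve.CubicSieve
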